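import Literature.MathematicalPhysics.QuantumFieldTheory.Balaban1983to89.B1TorusSubBoxOp
import Literature.MathematicalPhysics.QuantumFieldTheory.Balaban1983to89.B1Ineq225DerivRegularRegion

/-!
# `Balaban1983to89.B1Ineq225RegularBox` — T. Bałaban, *(Higgs)₂,₃ quantum fields in a finite volume. I*, Commun. Math. Phys. **85**
# (1982) 603–626 [Balaban1982Higgs1], PROP. 2.1 (2.25) VALUE AND DERIVATIVE MEMBERS **WITHOUT THE RESTRICTION dist(x, Ωᶜ) ≥ R₀** FOR
# BOXES OF LARGE BLOCKS `Ω ⊂ T_ε` on the (Higgs)₂,₃ carrier at every (2.23)-regular `A` — the sentence p. 611 l.1–2 «For some simple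
# sets Ω, e.g. for rectangular parallelepipeds, the inequalities hold without any restrictions on the points x, x′» (= [Balaban1983RegularityDecay]
# p. 579 «if Ω is a rectangular parallelepiped, then all □_j in the representation (2.13) are cubes and we can apply Lemma 2.2 to all
# operators in it»)

statement-level skeleton of published theorems with citation tags; proofs where landed; nothing here is a claim about the Yang–Mills mass gap

PDF held: `paper:balaban1982-cmp85-higgs23-i` pp. 610–611 [PDF 8–9] (`p0008.txt`, `p0009.txt`); `paper:balaban1983-cmp89-regularity-decay`
pp. 573, 575–579 [PDF 3, 5–9] (`p0003.txt` … `p0009.txt`), re-read by this seat.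

CITATION HEADER (lean-in-tree rule).  Cell `lit-balaban` (HOME `run/shared/lean/pub/lit-balaban/`), Phase-2 proof seat **p35** gen 15 (unit
`lit-balaban-p35`); SKELETON rows **B1.Prop2.1** / **B1.Eq2.25** (the parallelepiped clause of Prop. 2.1 on the concrete carrier: MODEL INSTANCE)
and **B4.Thm@573** (the sentence «for rectangular parallelepipeds, the inequalities hold without any restrictions», carrier instance).  USED BY
NAME, never restated: gen 12's region framework `B1TorusRegionCubes.{piece, fld, Hloc, Gloc, aOp, bOp, …}`, `B1TorusRegionRop.{chi, aOpP, bOpP,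
G0P, RopP, GP, GP_eq, …}`, `B1TorusLabelWalk`, `B1Ineq225RegionChain`, `B1Ineq225RegularRegion.{abs_acT_sub_le_of_reg_on, …}`,
`B1Ineq225DerivRegularRegion.{cube_deriv_sup, norm_covDeriv_le, exists_le_of_geometric}`, gen 8's `B1TorusCubeBoxOp.cube_inputs`, this seat's
gen-15 `B1TorusSubBoxChart` / `B1TorusSubBoxOp.subbox_inputs` / `B4Lemma22NoCollarContours`, r01's ABSTRACT chain
`B4Ineq110LpChain.lp_walk_bound_rem_exp`, gen 10's `B1TorusCubeDeriv.{covDeriv_hsmul, abs_sderiv_hTor_le}` («|∂^ηh_j| ≤ O(M⁻¹)»), r02's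
`B2Restr216Lattice.norm_U_apply`, `B1Ineq234LevelZero.{tdist_triangle_real, tdist_shift_le_one}`, the typer's `HiggsLattice`/`HiggsCovariance`.

WHAT IS PRINTED.  [B1] p. 610 [PDF 8] Prop. 2.1: *«… there exist positive constants δ₀, c₀, R₀ independent of A, k, Ω and depending on
d, a, M only, c₀ on α also, such that for an arbitrary function f : Ω → R^N we have … |(D^η_A G_k(Ω, A)f)(x)|, |(G_k(Ω, A)f)(x)| ≦
c₀ exp(−δ₀ dist(x, supp f))‖f‖_∞ (2.25) for x ∈ Ω, dist(x, Ω^c) ≧ R₀»*; p. 611 [PDF 9] l.1–2, verbatim: *«For some simple sets Ω, e.g.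
for rectangular parallelepipeds, the inequalities hold without any restrictions on the points x, x′.»*  [B4] p. 578 [PDF 8] L26–28,
verbatim (where the restriction `R₀` enters): *«the condition dist({x, x′}, Ωᶜ) ≧ R₀, together with the definition (2.19) of R₀ imply
that all □_{ω_i} are cubes contained in Ω.»*; p. 579 [PDF 9] L25–28, verbatim: *«It implies all the inequalities we need. Finally let us
notice that if Ω is a rectangular parallelepiped, then all □_j in the representation (2.13) are cubes and we can apply Lemma 2.2 to all
operators in it, so the restriction dist({x, x′}, Ωᶜ) ≧ R₀ is unnecessary.»*; p. 575 [PDF 5] L9 and L22–24, verbatim: *«□_j = Ω ∩ {a sum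
of large blocks for which the point Mj is one of the vertices}»*, *«where the configurations Ã_j are constructed in the following way: if
□_j intersects the boundary of Ω, then Ã_j = A; if □_j is an interior cube of Ω, then we take Ã_j as equal to A on the cube
{x : |x − Mj| ≦ (3/4)M}, and changing regularly to a constant function in a neighbourhood of a boundary of □_j.»*  (v1.1, p35 gen 17:
the three [B4] quotations re-set from the text layer `p0005.txt`/`p0008.txt`/`p0009.txt` (the p. 575 cube radius `¾M` from the render
`1983-cmp89-regularity-decay-p005-x2.png`) — ref-4 S-B1-g54-1 (a)(b); v1.0 carried a paraphrase of p. 578/579 marked «verbatim» and a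
paraphrase of the p. 575 Ã_j sentence inside guillemets; no declaration changed.)

READING PROVED HERE.  «Rectangular parallelepiped» ↦ a CELL-PRODUCT set of large blocks of `T_ε`: `Ω = cellBox S = {x : ∀μ, ⌊x_μ/M⌋ ∈ S_μ}`
for arbitrary sets `S_μ` of cell indices (`M = L^K·K₀` fine sites; every box of large blocks — one large block, one window `□_j`, any
product of intervals of large blocks, also wrapping the torus — is of this form).  For such `Ω` EVERY piece `Ω ∩ □_j` is, in the box
coordinates of a neighbouring window label, a sub-box `Π_i[0, L^K·M_i)` with `M_i ∈ {K₀, 2K₀}` (`piece_cellBox_eq_boxT`), so the raw field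
«Ã_j = A» carries Lemma 2.2 (2.17) sup members and (2.20) on every piece (`B1TorusSubBoxOp.subbox_inputs`), and r01's abstract walk (2.18)–(2.22)
runs with ALL labels «good»: no `R₀`.  Hypotheses: `K ≤ K_P`, `K ≥ 1`, `K₀ ∣ M_P`, `K₀ ≥ K₀min`, `3M ≤ |T_ε|_μ`, `m² > 0` with `m²(L^Kε)² ≤ m²ε₀²`,
`L ≥ 2`, (2.23) on `Ω` in gen 11's form `(L^Kε|e|/e_K)|A_ν(z + εe_μ) − A_ν(z)| ≤ c·e_K^{β−1}/L^K`, `z ∈ Ω`.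

WHAT THIS FILE PROVES (kernel-checked, zero `sorry`; definitions with bodies + theorems; no `def … : Prop` fact).
* §1 `cellOf`, `cellBox S` (+ `mem_cellBox`, `isBigBlockUnion_cellBox`, `cellBox_blockSat`), the piece geometry: `qOf`, `boxCoord_eq_qOf`,
  `mem_cube_iff_qOf`, `loCell`/`hiCell`, `tB`/`mB`/`MbB`/`jB`/`jlB`, **`piece_cellBox_eq_boxT`** (every nonempty piece `Ω ∩ □_j` is the
  sub-box `boxT (jB) (MbB)` of a neighbouring window label, sides `M_i ∈ {K₀, 2K₀}`), `piece_cellBox_empty`, `hTor_smul_supported_piece`,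
  **`hTor_toT_jB`** (the window bump `h_j` reads `hZ n K₀ (1 − t)` along the neighbouring chart).
* §2 the sup-norm tails `norm_RopP_le` (`‖(R1_Ω)g‖_∞ ≤ 2^dβ‖g‖_∞`), `norm_RopP_pow_le`, `exists_value_tail_le`, `exists_deriv_tail_le'`
  (finite-dimensional, from the sup letters only) and **`chain_allgood_of_inputs_probe`** — r01's abstract chain for a region whose EVERY
  label carries the sup letters (good := all labels, constant grading, `n₀ = 1`, `V = 1`): `Φ(G^ε_K(Ω,A)1_Ωf) ≤ 2|X₀|2^d·γ·e^{−(Dist − 4rS)/(2M)}‖f‖_∞`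
  for a subadditive probe reading `X₀`, NO `R₀`.
* §3 `abs_acT_sub_le_of_reg_on_boxT` and **`box_letters`** — AT EVERY LABEL of a cell-product box under (2.23) on `Ω`, for `Ω`-supported `ψ`:
  `‖G_j(h_jψ)‖_∞ ≤ C_g(L^Kε)²‖ψ‖_∞`, `‖D^ε_A(h_jG_j(h_jψ))(b)‖ ≤ C_g(L^Kε)‖ψ‖_∞` on the bonds `b` inside `Ω`, `‖b_jψ‖_∞ ≤ (C_m/K₀)‖ψ‖_∞`
  (interior windows: gen 8/12 `cube_inputs`/`cube_deriv_sup`; boundary pieces: `B1TorusSubBoxOp.subbox_inputs` at «Ã_j = A» + Leibniz).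
* §4 **`norm_propagatorK_box_reg_decay`** — PROP. 2.1 (2.25) VALUE MEMBER FOR `Ω = cellBox S` AT EVERY (2.23)-REGULAR `A`, EVERY SITE `x`
  (no `R₀`): `‖(G^ε_K(Ω, A)1_Ωg)(x)‖ ≤ c₀(L^Kε)²·exp(−D/(2K₀L^K))·M′` for `g` supported in a `K`-block, `‖g‖_∞ ≤ M′`, vanishing within `D` of
  `x`; **`norm_covDeriv_propagatorK_box_reg_decay`** — THE DERIVATIVE MEMBER at every bond `⟨x, x + εe_μ⟩` with both ends in `Ω` (no `R₀`):
  `‖(D^ε_A G^ε_K(Ω, A)1_Ωg)(⟨x, μ⟩)‖ ≤ c₁(L^Kε)·exp(−D/(2K₀L^K))·M′`.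
HONEST SCOPE.  (i) `Ω` a cell-product of large blocks of size `M = L^KK₀` with `K₀ ∣ M_P`, `3M ≤ |T_ε|_μ` (the print's parallelepipeds of
large blocks, also wrapping the torus; a general big-block union with non-box pieces is gen 12's `B1Ineq225RegularRegion` /
`B1Ineq225DerivRegularRegion`, under `R₀`); (ii) the derivative member is stated on the bonds of `Ω` (both ends in `Ω`: the Neumann operator's
bonds), in the operator form of gens 10–12; (iii) constants existential but explicit in the proofs (`δ₀ = 1/(2K₀)` per `L^Kε`, `c₀`, `c₁`,
`K₀min`, `e₁` functions of `(d, L, a, m²ε₀², N, (e,q), c, β)` and `K₀`), not optimised; (iv) `g` in one `K`-block (arbitrary `g` by block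
summation exactly as `B1Ineq225RegularRegion.norm_propagatorK_region_reg_decay_sum`); (v) (2.23) is used on `Ω` only (`z ∈ Ω`, the
neighbour `z + εe_μ` anywhere), as in gen 11/12.  Unit `lit-balaban-p35` gen 15 (literature-prover-lit-balaban-p35-g15-0).
-/

open scoped BigOperators

noncomputable section

namespace Literature.MathematicalPhysics.QuantumFieldTheory.Balaban1983to89.B1Ineq225RegularBox

open Literature.MathematicalPhysics.QuantumFieldTheory.Balaban1983to89.HiggsLattice
open Literature.MathematicalPhysics.QuantumFieldTheory.Balaban1983to89.HiggsAveraging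
open Literature.MathematicalPhysics.QuantumFieldTheory.Balaban1983to89.HiggsCovariance
open Literature.MathematicalPhysics.QuantumFieldTheory.Balaban1983to89.HiggsCovarianceCont (sNorm)
open Literature.MathematicalPhysics.QuantumFieldTheory.Balaban1983to89.B1TorusCubeCover
open Literature.MathematicalPhysics.QuantumFieldTheory.Balaban1983to89.B1TorusCubeLocality26
open Literature.MathematicalPhysics.QuantumFieldTheory.Balaban1983to89.B1TorusCubeChart
open Literature.MathematicalPhysics.QuantumFieldTheory.Balaban1983to89.B1TorusCubeBoxOp (acT cube_inputs hTor_smul_eq_zero_off half_cast)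
open Literature.MathematicalPhysics.QuantumFieldTheory.Balaban1983to89.B1TorusSubBoxChart
open Literature.MathematicalPhysics.QuantumFieldTheory.Balaban1983to89.B1TorusSubBoxOp (subbox_inputs)
open Literature.MathematicalPhysics.QuantumFieldTheory.Balaban1983to89.B1TorusRegionCubes
open Literature.MathematicalPhysics.QuantumFieldTheory.Balaban1983to89.B1TorusRegionHSizes (IsBigBlockUnion blockSat_of_isBigBlockUnion)
open Literature.MathematicalPhysics.QuantumFieldTheory.Balaban1983to89.B1TorusRegionRop
open Literature.MathematicalPhysics.QuantumFieldTheory.Balaban1983to89.B1TorusLabelWalk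
open Literature.MathematicalPhysics.QuantumFieldTheory.Balaban1983to89.B1Ineq225RegionChain (cube_subset_of_near)
open Literature.MathematicalPhysics.QuantumFieldTheory.Balaban1983to89.B1Ineq225RegularRegion (abs_acT_sub_le_of_reg_on rS_le_real Gloc_of_good
  bOp_of_good)
open Literature.MathematicalPhysics.QuantumFieldTheory.Balaban1983to89.B1Ineq225RegularTorus (abs_chartScale)
open Literature.MathematicalPhysics.QuantumFieldTheory.Balaban1983to89.B1Ineq225DerivRegularRegion (norm_covDeriv_le exists_le_of_geometric
  cube_deriv_sup covDeriv_zero' covDeriv_add' covDeriv_aOp_eq_zero)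
open Literature.MathematicalPhysics.QuantumFieldTheory.Balaban1983to89.B1TorusCubeDeriv (covDeriv_hsmul abs_sderiv_hTor_le)
open Literature.MathematicalPhysics.QuantumFieldTheory.Balaban1983to89.B2Restr216Lattice (norm_U_apply)
open Literature.MathematicalPhysics.QuantumFieldTheory.Balaban1983to89.B1Ineq234LevelZero (tdist_triangle_real tdist_shift_le_one)
open Literature.MathematicalPhysics.QuantumFieldTheory.Balaban1983to89.B4Ineq110LpChain (lp_walk_bound_rem_exp)
open Literature.MathematicalPhysics.QuantumFieldTheory.Balaban1983to89.B4Reflection242 (boxDom mem_boxDom)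
open Literature.MathematicalPhysics.QuantumFieldTheory.Balaban1983to89.B4Lower18Regular (e1 e1_apply_self e1_apply_ne)
open Literature.MathematicalPhysics.QuantumFieldTheory.Balaban1983to89.B4Lemma22ReduceZero (Box)
open Literature.MathematicalPhysics.QuantumFieldTheory.Balaban1983to89.B4Eq220PartitionSizes (hZ)
open Literature.MathematicalPhysics.QuantumFieldTheory.Balaban1983to89.B4PartitionUnity22 (hprof hCube D1 D2 D1_nonneg D2_nonneg contDiff_hprof
  hasCompactSupport_hprof)

variable {P : HiggsLattice.Params} {N : ℕ}

/-- `K₀ ≥ 8 ⇒ K₀ ≥ 1`. [folklore] -/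
private theorem one_le_of_eight_le {K₀ : ℕ} (hK₀8 : 8 ≤ K₀) : 1 ≤ K₀ := le_trans (by norm_num) hK₀8

/-! ## §1 Cell-product boxes of large blocks and the geometry of their pieces -/

section Cells

variable (K K₀ : ℕ)

/-- The LARGE-BLOCK (cell) index of a torus site in direction `μ`: `⌊x_μ/M⌋`, `M = L^K·K₀` fine sites.
[cite: Balaban1983RegularityDecay, §2 p.575 «a sum of large blocks»] -/
def cellOf (x : HiggsLattice.Site P 0) (μ : Fin P.d) : ℕ := (x μ).val / half P K K₀

/-- **A CELL-PRODUCT BOX OF LARGE BLOCKS** («rectangular parallelepiped» built of large blocks, [B1] p. 611 l.1–2): the sites whose cell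
index in direction `μ` lies in `S_μ`, for every `μ`. [cite: Balaban1982Higgs1, Prop. 2.1 p.611 l.1–2] -/
def cellBox (S : Fin P.d → Finset ℕ) : Finset (HiggsLattice.Site P 0) :=
  Finset.univ.filter fun x => ∀ μ, cellOf K K₀ x μ ∈ S μ

variable {K K₀}

/-- Membership in a cell-product box. [cite: Balaban1982Higgs1, Prop. 2.1 p.611 l.1–2] -/
theorem mem_cellBox {S : Fin P.d → Finset ℕ} {x : HiggsLattice.Site P 0} :
    x ∈ cellBox K K₀ S ↔ ∀ μ, cellOf K K₀ x μ ∈ S μ := by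
  unfold cellBox; rw [Finset.mem_filter]; simp

/-- A cell-product box is a union of large blocks (gen 12's `IsBigBlockUnion`). [cite: Balaban1983RegularityDecay, p.572 «We consider subsets Ω which are unions of big blocks»] -/
theorem isBigBlockUnion_cellBox (S : Fin P.d → Finset ℕ) : IsBigBlockUnion K K₀ (cellBox K K₀ S) := by
  intro x x' h
  rw [mem_cellBox, mem_cellBox]
  unfold cellOf
  simp only [h]

/-- Hence membership depends on the `K`-block only (`K ≤ K_P`). [cite: Balaban1983RegularityDecay, §2 p.575] -/
theorem cellBox_blockSat (hK : K ≤ P.K) (S : Fin P.d → Finset ℕ) :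
    ∀ x x' : HiggsLattice.Site P 0, blockIter K x = blockIter K x' → (x ∈ cellBox K K₀ S ↔ x' ∈ cellBox K K₀ S) :=
  blockSat_of_isBigBlockUnion hK (isBigBlockUnion_cellBox S)

/-- There are at least three cells per direction (`3M ≤ |T_ε|_μ`). [cite: Balaban1982Higgs1, (1.2) p.604] -/
theorem three_le_nLab (hK : K ≤ P.K) (hK₀ : K₀ ∣ P.M) (hN3 : ∀ μ, 3 * half P K K₀ ≤ P.sitesPerDir 0 μ) (hK₀' : 1 ≤ K₀)
    (μ : Fin P.d) : 3 ≤ nLab P K K₀ μ := by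
  have e := nLab_mul_half hK hK₀ μ
  have h := hN3 μ
  rw [← e] at h
  exact Nat.le_of_mul_le_mul_right h (half_pos hK₀')

/-- The cell index is `< N_μ` (number of cells per direction). [cite: Balaban1982Higgs1, (1.2) p.604] -/
theorem cellOf_lt (hK : K ≤ P.K) (hK₀ : K₀ ∣ P.M) (hK₀' : 1 ≤ K₀) (x : HiggsLattice.Site P 0) (μ : Fin P.d) :
    cellOf K K₀ x μ < nLab P K K₀ μ := by
  unfold cellOf
  rw [Nat.div_lt_iff_lt_mul (half_pos hK₀'), nLab_mul_half hK hK₀]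
  exact ZMod.val_lt _

/-- THE RELATIVE CELL POSITION of `x` with respect to the window `□_j` in direction `μ`: `q = (⌊x_μ/M⌋ + 1 − j_μ) mod N_μ ∈ [0, N_μ)`
(`q = 0`: the large block below `Mj`, `q = 1`: the one above). [cite: Balaban1983RegularityDecay, §2 p.575] -/
def qOf (j : Lab P K K₀) (x : HiggsLattice.Site P 0) (μ : Fin P.d) : ℤ :=
  ((cellOf K K₀ x μ : ℤ) + 1 - ((j μ : ℕ) : ℤ)) % (nLab P K K₀ μ : ℤ)

/-- `0 ≤ q`. [cite: Balaban1983RegularityDecay, §2 p.575] -/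
theorem qOf_nonneg (hK : K ≤ P.K) (hK₀ : K₀ ∣ P.M) (hK₀' : 1 ≤ K₀) (j : Lab P K K₀) (x : HiggsLattice.Site P 0) (μ : Fin P.d) :
    0 ≤ qOf j x μ := by
  unfold qOf
  have : (0 : ℤ) < nLab P K K₀ μ := by exact_mod_cast lt_of_lt_of_le (by norm_num) (two_le_nLab hK hK₀ hK₀' μ)
  exact Int.emod_nonneg _ this.ne'

/-- `q < N_μ`. [cite: Balaban1983RegularityDecay, §2 p.575] -/
theorem qOf_lt (hK : K ≤ P.K) (hK₀ : K₀ ∣ P.M) (hK₀' : 1 ≤ K₀) (j : Lab P K K₀) (x : HiggsLattice.Site P 0) (μ : Fin P.d) :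
    qOf j x μ < nLab P K K₀ μ := by
  unfold qOf
  have : (0 : ℤ) < nLab P K K₀ μ := by exact_mod_cast lt_of_lt_of_le (by norm_num) (two_le_nLab hK hK₀ hK₀' μ)
  exact Int.emod_lt_of_pos _ this

/-- `(hq + r) mod (hn) = h·(q mod n) + r` for `0 ≤ r < h`, `0 < n`. [folklore] -/
private theorem mul_add_emod_mul {h n q r : ℤ} (hh : 0 < h) (hn : 0 < n) (hr0 : 0 ≤ r) (hr : r < h) :
    (h * q + r) % (h * n) = h * (q % n) + r := by
  have hq : q % n = q - n * (q / n) := Int.emod_def q n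
  have h1 : h * q + r = (h * (q % n) + r) + (h * n) * (q / n) := by
    rw [hq]
    ring
  rw [h1, Int.add_mul_emod_self_left]
  have hm0 : 0 ≤ q % n := Int.emod_nonneg _ hn.ne'
  have hm1 : q % n < n := Int.emod_lt_of_pos _ hn
  refine Int.emod_eq_of_lt (by positivity) ?_
  have : q % n + 1 ≤ n := hm1
  nlinarith

/-- **THE BOX COORDINATE IN TERMS OF CELLS**: `boxCoord_j(x)_μ = M·q + (x_μ mod M)`. [cite: Balaban1983RegularityDecay, §2 p.575] -/
theorem boxCoord_eq_qOf (hK : K ≤ P.K) (hK₀ : K₀ ∣ P.M) (hK₀' : 1 ≤ K₀) (j : Lab P K K₀) (x : HiggsLattice.Site P 0) (μ : Fin P.d) :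
    boxCoord K K₀ j x μ = (half P K K₀ : ℤ) * qOf j x μ + (((x μ).val % half P K K₀ : ℕ) : ℤ) := by
  have hh : (0 : ℤ) < half P K K₀ := by exact_mod_cast half_pos hK₀'
  have hn : (0 : ℤ) < nLab P K K₀ μ := by exact_mod_cast lt_of_lt_of_le (by norm_num) (two_le_nLab hK hK₀ hK₀' μ)
  have hS : (P.sitesPerDir 0 μ : ℤ) = (half P K K₀ : ℤ) * nLab P K K₀ μ := by
    rw [← nLab_mul_half hK hK₀ μ]; push_cast; ring
  unfold boxCoord qOf cellOf ctr
  -- the `ZMod` difference as the residue of an integer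
  have e : (x μ - (((half P K K₀ : ℤ) * ((j μ : ℕ) : ℤ) - half P K K₀ : ℤ) : ZMod (P.sitesPerDir 0 μ)))
      = ((((x μ).val : ℤ) - ((half P K K₀ : ℤ) * ((j μ : ℕ) : ℤ) - half P K K₀) : ℤ) : ZMod (P.sitesPerDir 0 μ)) := by
    push_cast
    rw [ZMod.natCast_zmod_val]
  rw [e, ZMod.val_intCast, hS]
  have hdiv : (((x μ).val % half P K K₀ : ℕ) : ℤ) = ((x μ).val : ℤ) - (half P K K₀ : ℤ) * (((x μ).val / half P K K₀ : ℕ) : ℤ) := by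
    rw [Int.natCast_mod, Int.natCast_div, Int.emod_def]
  have hv : (((x μ).val : ℕ) : ℤ) - ((half P K K₀ : ℤ) * ((j μ : ℕ) : ℤ) - half P K K₀)
      = (half P K K₀ : ℤ) * ((((x μ).val / half P K K₀ : ℕ) : ℤ) + 1 - ((j μ : ℕ) : ℤ)) + (((x μ).val % half P K K₀ : ℕ) : ℤ) := by
    rw [hdiv]
    ring
  rw [hv]
  exact mul_add_emod_mul hh hn (by positivity) (by exact_mod_cast Nat.mod_lt _ (half_pos hK₀'))

/-- `hq + r < hm ⇔ q < m` for `0 ≤ r < h`. [folklore] -/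
private theorem mul_add_lt_mul_iff {h q r m : ℤ} (hh : 0 < h) (hr0 : 0 ≤ r) (hr : r < h) : h * q + r < h * m ↔ q < m := by
  constructor
  · intro hlt
    by_contra hge
    rw [not_lt] at hge
    nlinarith
  · intro hlt
    have : q + 1 ≤ m := hlt
    nlinarith

/-- **THE WINDOW IN TERMS OF CELLS**: `x ∈ □_j ⇔ q_μ ≤ 1` for all `μ` (the two large blocks with vertex `Mj`).
[cite: Balaban1983RegularityDecay, §2 p.575] -/
theorem mem_cube_iff_qOf (hK : K ≤ P.K) (hK₀ : K₀ ∣ P.M) (hK₀' : 1 ≤ K₀) (j : Lab P K K₀) (x : HiggsLattice.Site P 0) :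
    x ∈ cube K K₀ j ↔ ∀ μ, qOf j x μ ≤ 1 := by
  rw [mem_cube, inCube_iff_boxCoord_lt hK hK₀ hK₀' j x]
  have hh : (0 : ℤ) < half P K K₀ := by exact_mod_cast half_pos hK₀'
  refine forall_congr' fun μ => ?_
  rw [boxCoord_eq_qOf hK hK₀ hK₀' j x μ, show (2 : ℤ) * (half P K K₀ : ℤ) = (half P K K₀ : ℤ) * 2 by ring,
    mul_add_lt_mul_iff hh (by positivity) (by exact_mod_cast Nat.mod_lt _ (half_pos hK₀'))]
  omega

/-- The large block BELOW `Mj` in direction `μ` (cell index `j_μ − 1 mod N_μ`, relative position `q = 0`).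
[cite: Balaban1983RegularityDecay, §2 p.575] -/
def loCell (j : Lab P K K₀) (μ : Fin P.d) : ℕ := ((j μ : ℕ) + (nLab P K K₀ μ - 1)) % nLab P K K₀ μ

/-- The large block ABOVE `Mj` in direction `μ` (cell index `j_μ`, relative position `q = 1`). [cite: Balaban1983RegularityDecay, §2 p.575] -/
def hiCell (j : Lab P K K₀) (μ : Fin P.d) : ℕ := (j μ : ℕ)

/-- `q = 0 ⇔ ⌊x_μ/M⌋` is the cell below `Mj`. [cite: Balaban1983RegularityDecay, §2 p.575] -/
theorem qOf_eq_zero_iff (hK : K ≤ P.K) (hK₀ : K₀ ∣ P.M) (hK₀' : 1 ≤ K₀) (j : Lab P K K₀) (x : HiggsLattice.Site P 0) (μ : Fin P.d) :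
    qOf j x μ = 0 ↔ cellOf K K₀ x μ = loCell j μ := by
  have hn2 := two_le_nLab hK hK₀ hK₀' μ
  have hc := cellOf_lt hK hK₀ hK₀' x μ
  have hj := (j μ).isLt
  unfold qOf loCell
  set n := nLab P K K₀ μ with hn_def
  set c := cellOf K K₀ x μ
  set a := (j μ : ℕ)
  have hnz : (n : ℤ) ≠ 0 := by exact_mod_cast (show n ≠ 0 by omega)
  constructor
  · intro h
    have hdvd : (n : ℤ) ∣ (c : ℤ) + 1 - a := Int.dvd_of_emod_eq_zero h
    zify
    rw [Nat.cast_sub (by omega : 1 ≤ n)]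
    obtain ⟨t, ht⟩ := hdvd
    have : ((a : ℤ) + (n - 1)) % n = c := by
      have e : (a : ℤ) + (n - 1) = c + n * (1 - t) := by linarith
      rw [e, Int.add_mul_emod_self_left]
      exact Int.emod_eq_of_lt (by positivity) (by exact_mod_cast hc)
    push_cast
    exact this.symm
  · intro h
    rw [h]
    have e : ((((a + (n - 1)) % n : ℕ)) : ℤ) = ((a : ℤ) + ((n : ℤ) - 1)) % n := by
      rw [Int.natCast_mod]; push_cast [Nat.cast_sub (by omega : 1 ≤ n)]; rfl
    rw [e]
    have key : ((a : ℤ) + ((n : ℤ) - 1)) % n + 1 - a ≡ 0 [ZMOD n] := by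
      have h1 : ((a : ℤ) + ((n : ℤ) - 1)) % n ≡ (a : ℤ) + ((n : ℤ) - 1) [ZMOD n] := Int.mod_modEq _ _
      calc ((a : ℤ) + ((n : ℤ) - 1)) % n + 1 - a ≡ ((a : ℤ) + ((n : ℤ) - 1)) + 1 - a [ZMOD n] :=
            (h1.add_right 1).sub_right _
        _ = n := by ring
        _ ≡ 0 [ZMOD n] := by simp [Int.ModEq]
    exact key

/-- `q = 1 ⇔ ⌊x_μ/M⌋` is the cell above `Mj`. [cite: Balaban1983RegularityDecay, §2 p.575] -/
theorem qOf_eq_one_iff (hK : K ≤ P.K) (hK₀ : K₀ ∣ P.M) (hK₀' : 1 ≤ K₀) (j : Lab P K K₀) (x : HiggsLattice.Site P 0) (μ : Fin P.d) :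
    qOf j x μ = 1 ↔ cellOf K K₀ x μ = hiCell j μ := by
  have hn2 := two_le_nLab hK hK₀ hK₀' μ
  have hc := cellOf_lt hK hK₀ hK₀' x μ
  have hj := (j μ).isLt
  unfold qOf hiCell
  set n := nLab P K K₀ μ
  set c := cellOf K K₀ x μ
  set a := (j μ : ℕ)
  constructor
  · intro h
    have h1 : ((c : ℤ) + 1 - a) % n = 1 % n := by rw [h]; exact (Int.emod_eq_of_lt (by norm_num) (by exact_mod_cast hn2)).symm
    have hdvd := Int.ModEq.dvd h1.symm
    obtain ⟨t, ht⟩ := hdvd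
    -- `c − a = n·(−t)` with `|c − a| < n` forces `t = 0`
    have e : (c : ℤ) - a = n * t := by linarith
    have hc' : (c : ℤ) < n := by exact_mod_cast hc
    have ha' : (a : ℤ) < n := by exact_mod_cast hj
    have hn0 : (0 : ℤ) ≤ n := by positivity
    have ht0 : t = 0 := by
      rcases lt_trichotomy t 0 with hlt | heq | hgt
      · have : t ≤ -1 := by omega
        nlinarith
      · exact heq
      · have : (1 : ℤ) ≤ t := by omega
        nlinarith
    rw [ht0, mul_zero, sub_eq_zero] at e
    exact_mod_cast e
  · intro h
    rw [h]
    rw [show (a : ℤ) + 1 - a = 1 by ring]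
    exact Int.emod_eq_of_lt (by norm_num) (by exact_mod_cast hn2)

variable (K K₀)

/-- The chart offset `t_μ ∈ {0, 1}` of the piece at `□_j`: `0` if the cell below `Mj` belongs to `Ω`, else `1`.
[cite: Balaban1983RegularityDecay, §2 p.575] -/
def tB (S : Fin P.d → Finset ℕ) (j : Lab P K K₀) (μ : Fin P.d) : ℕ := if loCell j μ ∈ S μ then 0 else 1

/-- The number `m_μ ∈ {1, 2}` of cells of the piece at `□_j` in direction `μ` (when the piece is non-empty).
[cite: Balaban1983RegularityDecay, §2 p.575] -/
def mB (S : Fin P.d → Finset ℕ) (j : Lab P K K₀) (μ : Fin P.d) : ℕ := if loCell j μ ∈ S μ ∧ hiCell j μ ∈ S μ then 2 else 1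

/-- The sides `M_i = m_μ·K₀ ∈ {K₀, 2K₀}` of the piece as a sub-box. [cite: Balaban1983RegularityDecay, §2 p.575] -/
def MbB (S : Fin P.d → Finset ℕ) (j : Lab P K K₀) : Fin (dd P + 1) → ℕ := fun i => mB K K₀ S j (castD P i) * K₀

/-- The chart label of the piece: the neighbouring window `j + t`. [cite: Balaban1983RegularityDecay, §2 p.575] -/
def jB (hK : K ≤ P.K) (hK₀ : K₀ ∣ P.M) (hK₀' : 1 ≤ K₀) (S : Fin P.d → Finset ℕ) (j : Lab P K K₀) : Lab P K K₀ :=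
  fun μ => ⟨((j μ : ℕ) + tB K K₀ S j μ) % nLab P K K₀ μ,
    Nat.mod_lt _ (lt_of_lt_of_le (by norm_num) (two_le_nLab hK hK₀ hK₀' μ))⟩

/-- The label of the window bump `h_j` in the chart of the piece: `jl = 1 − t`. [cite: Balaban1983RegularityDecay, §2 p.575] -/
def jlB (S : Fin P.d → Finset ℕ) (j : Lab P K K₀) : Fin (dd P + 1) → ℤ := fun i => 1 - (tB K K₀ S j (castD P i) : ℤ)

variable {K K₀}

/-- `t_μ ≤ 1`. [cite: Balaban1983RegularityDecay, §2 p.575] -/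
theorem tB_le_one (S : Fin P.d → Finset ℕ) (j : Lab P K K₀) (μ : Fin P.d) : tB K K₀ S j μ ≤ 1 := by
  unfold tB; split_ifs <;> norm_num

/-- `1 ≤ m_μ ≤ 2`. [cite: Balaban1983RegularityDecay, §2 p.575] -/
theorem mB_mem (S : Fin P.d → Finset ℕ) (j : Lab P K K₀) (μ : Fin P.d) : 1 ≤ mB K K₀ S j μ ∧ mB K K₀ S j μ ≤ 2 := by
  unfold mB; split_ifs <;> norm_num

/-- `t_μ + m_μ ≤ 2`. [cite: Balaban1983RegularityDecay, §2 p.575] -/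
theorem tB_add_mB_le (S : Fin P.d → Finset ℕ) (j : Lab P K K₀) (μ : Fin P.d) : tB K K₀ S j μ + mB K K₀ S j μ ≤ 2 := by
  unfold tB mB
  by_cases h1 : loCell j μ ∈ S μ
  · rw [if_pos h1]; split_ifs <;> norm_num
  · rw [if_neg h1, if_neg (fun h => h1 h.1)]

/-- The sides of the piece: `1 ≤ M_i`. [cite: Balaban1983RegularityDecay, §2 p.575] -/
theorem one_le_MbB (hK₀' : 1 ≤ K₀) (S : Fin P.d → Finset ℕ) (j : Lab P K K₀) (i : Fin (dd P + 1)) : 1 ≤ MbB K K₀ S j i := by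
  unfold MbB; have := (mB_mem (K := K) (K₀ := K₀) S j (castD P i)).1; nlinarith

/-- The sides of the piece: `M_i ≤ 2K₀`. [cite: Balaban1983RegularityDecay, §2 p.575] -/
theorem MbB_le (S : Fin P.d → Finset ℕ) (j : Lab P K K₀) (i : Fin (dd P + 1)) : MbB K K₀ S j i ≤ 2 * K₀ := by
  unfold MbB; have := (mB_mem (K := K) (K₀ := K₀) S j (castD P i)).2; nlinarith

/-- The sides of the piece: `K₀ ∣ M_i`. [cite: Balaban1983RegularityDecay, §2 p.575] -/
theorem dvd_MbB (S : Fin P.d → Finset ℕ) (j : Lab P K K₀) (i : Fin (dd P + 1)) : K₀ ∣ MbB K K₀ S j i := by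
  unfold MbB; exact Dvd.intro_left _ rfl

/-- **THE RELATIVE POSITION WITH RESPECT TO THE NEIGHBOURING WINDOW**: `q′ = (q − t) mod N_μ` for the label `j + t`.
[cite: Balaban1983RegularityDecay, §2 p.575] -/
theorem qOf_jB (hK : K ≤ P.K) (hK₀ : K₀ ∣ P.M) (hK₀' : 1 ≤ K₀) (S : Fin P.d → Finset ℕ) (j : Lab P K K₀)
    (x : HiggsLattice.Site P 0) (μ : Fin P.d) :
    qOf (jB K K₀ hK hK₀ hK₀' S j) x μ = (qOf j x μ - tB K K₀ S j μ) % (nLab P K K₀ μ : ℤ) := by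
  unfold qOf jB
  simp only
  set n := (nLab P K K₀ μ : ℤ)
  set c := (cellOf K K₀ x μ : ℤ)
  have hmod : ((((j μ : ℕ) + tB K K₀ S j μ) % nLab P K K₀ μ : ℕ) : ℤ) ≡ ((j μ : ℕ) : ℤ) + tB K K₀ S j μ [ZMOD n] := by
    push_cast
    exact Int.mod_modEq _ _
  have h1 : c + 1 - ((((j μ : ℕ) + tB K K₀ S j μ) % nLab P K K₀ μ : ℕ) : ℤ) ≡ c + 1 - (((j μ : ℕ) : ℤ) + tB K K₀ S j μ) [ZMOD n] :=
    Int.ModEq.sub_left _ hmod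
  have h2 : (c + 1 - ((j μ : ℕ) : ℤ)) % n - (tB K K₀ S j μ : ℤ) ≡ c + 1 - (((j μ : ℕ) : ℤ) + tB K K₀ S j μ) [ZMOD n] := by
    have := (Int.mod_modEq (c + 1 - ((j μ : ℕ) : ℤ)) n).sub_right (tB K K₀ S j μ : ℤ)
    refine this.trans ?_
    rw [show c + 1 - ((j μ : ℕ) : ℤ) - (tB K K₀ S j μ : ℤ) = c + 1 - (((j μ : ℕ) : ℤ) + tB K K₀ S j μ) by ring]
  exact h1.trans h2.symm

/-- **EVERY PIECE OF A CELL-PRODUCT BOX IS A SUB-BOX OF A NEIGHBOURING WINDOW**: if in every direction at least one of the two cells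
with vertex `Mj` lies in `Ω`, then `Ω ∩ □_j = boxT_{j+t}(Π[0, L^K·M_i))` with `M_i = m_μK₀`.
[cite: Balaban1983RegularityDecay, §2 p.575 «□_j = Ω ∩ {a sum of large blocks for which the point Mj is one of the vertices}», p.579 «all □_j … are cubes»] -/
theorem piece_cellBox_eq_boxT (hK : K ≤ P.K) (hK₀ : K₀ ∣ P.M) (hK₀' : 1 ≤ K₀) (hN3 : ∀ μ, 3 * half P K K₀ ≤ P.sitesPerDir 0 μ)
    (S : Fin P.d → Finset ℕ) (j : Lab P K K₀) (hall : ∀ μ, loCell j μ ∈ S μ ∨ hiCell j μ ∈ S μ) :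
    piece K K₀ (cellBox K K₀ S) j = boxT K K₀ (jB K K₀ hK hK₀ hK₀' S j) (MbB K K₀ S j) := by
  ext x
  rw [mem_piece, mem_cellBox, mem_cube_iff_qOf hK hK₀ hK₀' j x, mem_boxT_iff, mem_boxB_iff]
  have hh : (0 : ℤ) < half P K K₀ := by exact_mod_cast half_pos hK₀'
  -- coordinatewise
  have key : ∀ μ, (cellOf K K₀ x μ ∈ S μ ∧ qOf j x μ ≤ 1)
      ↔ (0 ≤ fromT K K₀ (jB K K₀ hK hK₀ hK₀' S j) x ((castD P).symm μ)
          ∧ fromT K K₀ (jB K K₀ hK hK₀ hK₀' S j) x ((castD P).symm μ)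
              < (P.L : ℤ) ^ K * MbB K K₀ S j ((castD P).symm μ)) := by
    intro μ
    have hn3 := three_le_nLab hK hK₀ hN3 hK₀' μ
    have hq0 := qOf_nonneg hK hK₀ hK₀' j x μ
    have hqn := qOf_lt hK hK₀ hK₀' j x μ
    have hq'0 := qOf_nonneg hK hK₀ hK₀' (jB K K₀ hK hK₀ hK₀' S j) x μ
    have e0 := qOf_eq_zero_iff hK hK₀ hK₀' j x μ
    have e1 := qOf_eq_one_iff hK hK₀ hK₀' j x μ
    unfold fromT
    rw [Equiv.apply_symm_apply, boxCoord_eq_qOf hK hK₀ hK₀' _ x μ, qOf_jB hK hK₀ hK₀' S j x μ]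
    unfold MbB
    rw [Equiv.apply_symm_apply]
    have hM : (P.L : ℤ) ^ K * ((mB K K₀ S j μ * K₀ : ℕ) : ℤ) = (half P K K₀ : ℤ) * (mB K K₀ S j μ : ℤ) := by
      unfold half; push_cast; ring
    rw [hM, mul_add_lt_mul_iff hh (by positivity) (by exact_mod_cast Nat.mod_lt _ (half_pos hK₀'))]
    have hr0 : (0 : ℤ) ≤ (half P K K₀ : ℤ) * ((qOf j x μ - (tB K K₀ S j μ : ℤ)) % (nLab P K K₀ μ : ℤ))
        + (((x μ).val % half P K K₀ : ℕ) : ℤ) := by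
      have : (0 : ℤ) ≤ (qOf j x μ - (tB K K₀ S j μ : ℤ)) % (nLab P K K₀ μ : ℤ) :=
        Int.emod_nonneg _ (by exact_mod_cast (show nLab P K K₀ μ ≠ 0 by omega))
      positivity
    simp only [hr0, true_and]
    set q := qOf j x μ with hq_def
    set n : ℤ := (nLab P K K₀ μ : ℤ) with hn_def
    have hn3' : (3 : ℤ) ≤ n := by rw [hn_def]; exact_mod_cast hn3
    unfold tB mB
    by_cases hlo : loCell j μ ∈ S μ
    · rw [if_pos hlo]
      push_cast
      rw [sub_zero, Int.emod_eq_of_lt hq0 hqn]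
      by_cases hhi : hiCell j μ ∈ S μ
      · rw [if_pos ⟨hlo, hhi⟩]
        constructor
        · rintro ⟨-, h⟩; linarith
        · intro h
          refine ⟨?_, by linarith⟩
          rcases (show q = 0 ∨ q = 1 by omega) with h0 | h1
          · rw [e0.1 h0]; exact hlo
          · rw [e1.1 h1]; exact hhi
      · rw [if_neg (fun h => hhi h.2)]
        constructor
        · rintro ⟨hc, h⟩
          rcases (show q = 0 ∨ q = 1 by omega) with h0 | h1
          · linarith
          · exact absurd (by rw [← e1.1 h1]; exact hc) hhi
        · intro h
          have h0 : q = 0 := by omega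
          exact ⟨by rw [e0.1 h0]; exact hlo, by linarith⟩
    · have hhi : hiCell j μ ∈ S μ := (hall μ).resolve_left hlo
      rw [if_neg hlo, if_neg (fun h => hlo h.1)]
      push_cast
      constructor
      · rintro ⟨hc, h⟩
        rcases (show q = 0 ∨ q = 1 by omega) with h0 | h1
        · exact absurd (by rw [← e0.1 h0]; exact hc) hlo
        · rw [h1]; norm_num
      · intro h
        -- `(q − 1) mod n < 1 ⇒ q = 1`
        have hq1 : q = 1 := by
          rcases (lt_trichotomy q 1) with hlt | heq | hgt
          · have hq0' : q = 0 := by omega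
            rw [hq0'] at h
            have : ((0 : ℤ) - 1) % n = n - 1 := by
              rw [show (0 : ℤ) - 1 = (n - 1) + n * (-1) by ring, Int.add_mul_emod_self_left]
              exact Int.emod_eq_of_lt (by linarith) (by linarith)
            rw [this] at h; linarith
          · exact heq
          · rw [Int.emod_eq_of_lt (by linarith) (by linarith)] at h; linarith
        exact ⟨by rw [e1.1 hq1]; exact hhi, by linarith⟩
  constructor
  · rintro ⟨hS, hq⟩ i
    have := (key (castD P i)).1 ⟨hS _, hq _⟩
    rwa [Equiv.symm_apply_apply] at this
  · intro h
    have h' : ∀ μ, cellOf K K₀ x μ ∈ S μ ∧ qOf j x μ ≤ 1 := fun μ => (key μ).2 (h _)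
    exact ⟨fun μ => (h' μ).1, fun μ => (h' μ).2⟩

/-- **AN EMPTY PIECE**: if in some direction neither cell with vertex `Mj` lies in `Ω`, then `Ω ∩ □_j = ∅`.
[cite: Balaban1983RegularityDecay, §2 p.575] -/
theorem piece_cellBox_empty (hK : K ≤ P.K) (hK₀ : K₀ ∣ P.M) (hK₀' : 1 ≤ K₀) (S : Fin P.d → Finset ℕ) (j : Lab P K K₀)
    {μ : Fin P.d} (hlo : loCell j μ ∉ S μ) (hhi : hiCell j μ ∉ S μ) : ∀ x, x ∉ piece K K₀ (cellBox K K₀ S) j := by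
  intro x hx
  rw [mem_piece, mem_cellBox, mem_cube_iff_qOf hK hK₀ hK₀' j x] at hx
  have hq0 := qOf_nonneg hK hK₀ hK₀' j x μ
  rcases (show qOf j x μ = 0 ∨ qOf j x μ = 1 by have := hx.2 μ; omega) with h0 | h1
  · exact hlo (by rw [← (qOf_eq_zero_iff hK hK₀ hK₀' j x μ).1 h0]; exact hx.1 μ)
  · exact hhi (by rw [← (qOf_eq_one_iff hK hK₀ hK₀' j x μ).1 h1]; exact hx.1 μ)

/-- `h_j·ψ` IS SUPPORTED IN THE PIECE when `ψ` is supported in `Ω` (`h_j` vanishes off `□_j`). [cite: Balaban1983RegularityDecay, (2.7) p.576] -/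
theorem hTor_smul_supported_piece (hK : K ≤ P.K) (hK₀ : K₀ ∣ P.M) (hK₀8 : 8 ≤ K₀) (Ω : Finset (HiggsLattice.Site P 0)) (j : Lab P K K₀)
    {ψ : HiggsLattice.ScalarField P 0 N} (hψ : ∀ x, x ∉ Ω → ψ x = 0) :
    ∀ x, x ∉ piece K K₀ Ω j → (hTor K K₀ j • ψ) x = 0 := by
  intro x hx
  rw [mem_piece, not_and_or] at hx
  rcases hx with hx | hx
  · rw [Pi.smul_apply', hψ x hx, smul_zero]
  · exact hTor_smul_eq_zero_off hK hK₀ hK₀8 j ψ hx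

/-- **THE WINDOW BUMP READS `hZ n K₀ (1 − t)` ALONG THE NEIGHBOURING CHART** on the piece's sub-box.
[cite: Balaban1983RegularityDecay, §2 p.575] -/
theorem hTor_toT_jB (hK : K ≤ P.K) (hK₀ : K₀ ∣ P.M) (hK₀' : 1 ≤ K₀) (S : Fin P.d → Finset ℕ) (j : Lab P K K₀) :
    ∀ y ∈ Box (dd P) (P.L - 1) K (MbB K K₀ S j),
      hTor K K₀ j (toT K K₀ (jB K K₀ hK hK₀ hK₀' S j) y) = hZ ((P.L - 1 + 1) ^ K) K₀ (jlB K K₀ S j) y := by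
  intro y hy
  rw [mem_boxB_iff] at hy
  -- the chart point of the neighbouring label is the chart point of `j` at `y + M·t`
  set w : Fin P.d → ℤ := fun μ => vecT y μ + (half P K K₀ : ℤ) * tB K K₀ S j μ with hw
  have hchart : toT K K₀ (jB K K₀ hK hK₀ hK₀' S j) y = chart K K₀ j w := by
    funext μ
    unfold toT chart ctr jB
    simp only [hw]
    have hS : ((P.sitesPerDir 0 μ : ℕ) : ℤ) = (half P K K₀ : ℤ) * nLab P K K₀ μ := by
      rw [← nLab_mul_half hK hK₀ μ]; push_cast; ring
    rw [ZMod.intCast_eq_intCast_iff_dvd_sub, hS]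
    have hm : ((((j μ : ℕ) + tB K K₀ S j μ) % nLab P K K₀ μ : ℕ) : ℤ)
        = ((j μ : ℕ) : ℤ) + tB K K₀ S j μ - (nLab P K K₀ μ : ℤ) * ((((j μ : ℕ) + tB K K₀ S j μ) / nLab P K K₀ μ : ℕ) : ℤ) := by
      rw [Int.natCast_mod, Int.natCast_div, Int.emod_def]; push_cast; ring
    rw [hm]
    exact ⟨((((j μ : ℕ) + tB K K₀ S j μ) / nLab P K K₀ μ : ℕ) : ℤ), by ring⟩
  have hw2 : ∀ μ, 0 ≤ w μ ∧ w μ < 2 * half P K K₀ := by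
    intro μ
    have h1 := hy ((castD P).symm μ)
    have ht := tB_add_mB_le (K := K) (K₀ := K₀) S j μ
    have hM : (P.L : ℤ) ^ K * (MbB K K₀ S j ((castD P).symm μ) : ℤ) = (half P K K₀ : ℤ) * mB K K₀ S j μ := by
      unfold MbB; rw [Equiv.apply_symm_apply]; unfold half; push_cast; ring
    rw [hM] at h1
    have hv : w μ = y ((castD P).symm μ) + (half P K K₀ : ℤ) * tB K K₀ S j μ := rfl
    rw [hv]
    have hh : (0 : ℤ) ≤ half P K K₀ := by positivity
    have ht2 : ((tB K K₀ S j μ : ℕ) : ℤ) + mB K K₀ S j μ ≤ 2 := by exact_mod_cast ht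
    have ht0 : (0 : ℤ) ≤ tB K K₀ S j μ := by positivity
    constructor
    · nlinarith [h1.1]
    · nlinarith [h1.2]
  rw [hchart, hTor_chart hK hK₀ hK₀' j hw2]
  unfold hZ hCube jlB
  rw [← (castD P).prod_comp]
  refine Finset.prod_congr rfl fun i _ => ?_
  have hhc := half_cast P K K₀
  have hh0 : (half P K K₀ : ℝ) ≠ 0 := by
    have := half_pos (P := P) (K := K) hK₀'; positivity
  have hK₀r : (K₀ : ℝ) ≠ 0 := by have := hK₀'; positivity
  have hn0 : ((((P.L - 1 + 1) ^ K : ℕ)) : ℝ) ≠ 0 := by positivity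
  congr 1
  have ev : ((w (castD P i) : ℤ) : ℝ) = (y i : ℝ) + (half P K K₀ : ℝ) * (tB K K₀ S j (castD P i) : ℝ) := by
    have : w (castD P i) = y i + (half P K K₀ : ℤ) * tB K K₀ S j (castD P i) := by
      show vecT y (castD P i) + _ = _; rw [vecT_castD]
    rw [this]; push_cast; ring
  rw [ev, hhc]
  push_cast
  field_simp
  ring

end Cells

/-! ## §2 The walk expansion with ALL labels good (no `R₀`) and the sup-norm tails -/

section Chain

variable (C : ChargeData N) {K K₀ : ℕ} (Ω : Finset (HiggsLattice.Site P 0)) (A : HiggsLattice.VecField P 0) {msq a : ℝ}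

/-- **THE SUP-NORM LETTER OF `R·1_Ω`**: if every letter has `‖b_jψ‖_∞ ≤ β‖ψ‖_∞` on the `Ω`-supported `ψ`, then
`‖(R1_Ω)g‖_∞ ≤ 2^dβ‖g‖_∞` (the row multiplicity `2^d` of the cores `{|x − Mj| ≤ rS}`). [cite: Balaban1983RegularityDecay, (2.13) p.577, (2.20) p.578] -/
theorem norm_RopP_le (hK : K ≤ P.K) (hK₀ : K₀ ∣ P.M) (hK₀8 : 8 ≤ K₀) {β : ℝ} (hβ : 0 ≤ β)
    (h0 : ∀ (j : Lab P K K₀) (ψ : HiggsLattice.ScalarField P 0 N), (∀ y, y ∉ Ω → ψ y = 0) →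
      ‖bOp C K K₀ Ω A msq a j ψ‖ ≤ β * ‖ψ‖)
    (g : HiggsLattice.ScalarField P 0 N) : ‖RopP C K K₀ Ω A msq a g‖ ≤ 2 ^ P.d * β * ‖g‖ := by
  classical
  refine (pi_norm_le_iff_of_nonneg (by positivity)).2 fun x => ?_
  rw [RopP_apply, Rop_apply, Finset.sum_apply]
  have hz : ∀ j ∈ (Finset.univ : Finset (Lab P K K₀)),
      j ∉ Finset.univ.filter (fun j : Lab P K K₀ => Near K K₀ (rS P K K₀) j x) →
      bOp C K K₀ Ω A msq a j (chi Ω • g) x = 0 := fun j _ hj =>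
    bOp_apply_eq_zero_off C Ω A msq a hK hK₀ hK₀8 j _ fun hn => hj (by rw [Finset.mem_filter]; exact ⟨Finset.mem_univ _, hn⟩)
  rw [← Finset.sum_subset (Finset.subset_univ _) hz]
  calc ‖∑ j ∈ Finset.univ.filter (fun j : Lab P K K₀ => Near K K₀ (rS P K K₀) j x), bOp C K K₀ Ω A msq a j (chi Ω • g) x‖
      ≤ ∑ j ∈ Finset.univ.filter (fun j : Lab P K K₀ => Near K K₀ (rS P K K₀) j x), ‖bOp C K K₀ Ω A msq a j (chi Ω • g) x‖ :=
        norm_sum_le _ _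
    _ ≤ ∑ _j ∈ Finset.univ.filter (fun j : Lab P K K₀ => Near K K₀ (rS P K K₀) j x), β * ‖g‖ :=
        Finset.sum_le_sum fun j _ => (norm_le_pi_norm _ x).trans
          ((h0 j _ (chi_smul_supported Ω g)).trans (mul_le_mul_of_nonneg_left (norm_chi_smul_le Ω g) hβ))
    _ = (Finset.univ.filter (fun j : Lab P K K₀ => Near K K₀ (rS P K K₀) j x)).card * (β * ‖g‖) := by
        rw [Finset.sum_const, nsmul_eq_mul]
    _ ≤ 2 ^ P.d * (β * ‖g‖) :=
        mul_le_mul_of_nonneg_right (by exact_mod_cast card_filter_near_rS_le hK hK₀ hK₀8 x) (by positivity)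
    _ = 2 ^ P.d * β * ‖g‖ := by ring

/-- `‖(R1_Ω)^m g‖_∞ ≤ (2^dβ)^m‖g‖_∞`. [cite: Balaban1983RegularityDecay, (2.12)–(2.13) p.577] -/
theorem norm_RopP_pow_le (hK : K ≤ P.K) (hK₀ : K₀ ∣ P.M) (hK₀8 : 8 ≤ K₀) {β : ℝ} (hβ : 0 ≤ β)
    (h0 : ∀ (j : Lab P K K₀) (ψ : HiggsLattice.ScalarField P 0 N), (∀ y, y ∉ Ω → ψ y = 0) →
      ‖bOp C K K₀ Ω A msq a j ψ‖ ≤ β * ‖ψ‖)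
    (m : ℕ) (g : HiggsLattice.ScalarField P 0 N) : ‖(RopP C K K₀ Ω A msq a ^ m) g‖ ≤ (2 ^ P.d * β) ^ m * ‖g‖ := by
  induction m generalizing g with
  | zero => simp
  | succ m ih =>
    rw [pow_succ, Module.End.mul_apply]
    calc ‖(RopP C K K₀ Ω A msq a ^ m) (RopP C K K₀ Ω A msq a g)‖ ≤ (2 ^ P.d * β) ^ m * ‖RopP C K K₀ Ω A msq a g‖ := ih _
      _ ≤ (2 ^ P.d * β) ^ m * (2 ^ P.d * β * ‖g‖) :=
          mul_le_mul_of_nonneg_left (norm_RopP_le C Ω A hK hK₀ hK₀8 hβ h0 g) (pow_nonneg (by positivity) _)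
      _ = (2 ^ P.d * β) ^ (m + 1) * ‖g‖ := by ring

/-- `G^ε_K(Ω, A)1_Ω` is a bounded operator of the finite-dimensional field space (some constant; only finiteness is used for the tail).
[cite: Balaban1982Higgs1, (2.20) p.610] -/
theorem exists_norm_GP_le : ∃ Cst : ℝ, 0 ≤ Cst ∧ ∀ v : HiggsLattice.ScalarField P 0 N, ‖GP C K Ω A msq a v‖ ≤ Cst * ‖v‖ := by
  refine ⟨‖LinearMap.toContinuousLinearMap (GP C K Ω A msq a)‖, norm_nonneg _, fun v => ?_⟩
  have h := (LinearMap.toContinuousLinearMap (GP C K Ω A msq a)).le_opNorm v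
  rwa [LinearMap.coe_toContinuousLinearMap'] at h

/-- **THE REMAINDER OF (2.12) AT A SITE, FROM THE SUP LETTERS ONLY**: `‖((G1_Ω)(R1_Ω)^m g)(x)‖ → 0` when `2^dβ < 1`.
[cite: Balaban1983RegularityDecay, (2.12) p.577 «so the series in the representation (2.12) is convergent»] -/
theorem exists_value_tail_le (hK : K ≤ P.K) (hK₀ : K₀ ∣ P.M) (hK₀8 : 8 ≤ K₀) {β : ℝ} (hβ : 0 ≤ β) (hsmall : 2 ^ P.d * β < 1)
    (h0 : ∀ (j : Lab P K K₀) (ψ : HiggsLattice.ScalarField P 0 N), (∀ y, y ∉ Ω → ψ y = 0) →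
      ‖bOp C K K₀ Ω A msq a j ψ‖ ≤ β * ‖ψ‖)
    (g : HiggsLattice.ScalarField P 0 N) (x : HiggsLattice.Site P 0) :
    ∀ ε' : ℝ, 0 < ε' → ∃ m : ℕ, ‖((GP C K Ω A msq a * RopP C K K₀ Ω A msq a ^ m) g) x‖ ≤ ε' := by
  obtain ⟨Cst, hC, hGP⟩ := exists_norm_GP_le C Ω A (K := K) (msq := msq) (a := a)
  refine exists_le_of_geometric (Φ := fun m => ‖((GP C K Ω A msq a * RopP C K K₀ Ω A msq a ^ m) g) x‖) (by positivity) hsmall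
    (mul_nonneg hC (norm_nonneg g)) fun m => ?_
  show ‖((GP C K Ω A msq a * RopP C K K₀ Ω A msq a ^ m) g) x‖ ≤ (2 ^ P.d * β) ^ m * (Cst * ‖g‖)
  rw [Module.End.mul_apply]
  calc ‖GP C K Ω A msq a ((RopP C K K₀ Ω A msq a ^ m) g) x‖ ≤ ‖GP C K Ω A msq a ((RopP C K K₀ Ω A msq a ^ m) g)‖ := norm_le_pi_norm _ x
    _ ≤ Cst * ‖(RopP C K K₀ Ω A msq a ^ m) g‖ := hGP _
    _ ≤ Cst * ((2 ^ P.d * β) ^ m * ‖g‖) := mul_le_mul_of_nonneg_left (norm_RopP_pow_le C Ω A hK hK₀ hK₀8 hβ h0 m g) hC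
    _ = (2 ^ P.d * β) ^ m * (Cst * ‖g‖) := by ring

/-- **THE REMAINDER OF (2.12) UNDER THE DERIVATIVE, FROM THE SUP LETTERS ONLY**: `‖D^ε_A((G1_Ω)(R1_Ω)^m g)(b)‖ → 0` when `2^dβ < 1`
(`|U| = 1`, both end-point values). [cite: Balaban1983RegularityDecay, (2.12) p.577] -/
theorem exists_deriv_tail_le' (hK : K ≤ P.K) (hK₀ : K₀ ∣ P.M) (hK₀8 : 8 ≤ K₀) {β : ℝ} (hβ : 0 ≤ β) (hsmall : 2 ^ P.d * β < 1)
    (h0 : ∀ (j : Lab P K K₀) (ψ : HiggsLattice.ScalarField P 0 N), (∀ y, y ∉ Ω → ψ y = 0) →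
      ‖bOp C K K₀ Ω A msq a j ψ‖ ≤ β * ‖ψ‖)
    (g : HiggsLattice.ScalarField P 0 N) (b : HiggsLattice.PBond P 0) :
    ∀ ε' : ℝ, 0 < ε' → ∃ m : ℕ, ‖covDeriv C A ((GP C K Ω A msq a * RopP C K K₀ Ω A msq a ^ m) g) b‖ ≤ ε' := by
  obtain ⟨Cst, hC, hGP⟩ := exists_norm_GP_le C Ω A (K := K) (msq := msq) (a := a)
  have hm := P.mesh_pos 0
  refine exists_le_of_geometric (Φ := fun m => ‖covDeriv C A ((GP C K Ω A msq a * RopP C K K₀ Ω A msq a ^ m) g) b‖) (by positivity)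
    hsmall (show 0 ≤ (P.mesh 0)⁻¹ * (2 * (Cst * ‖g‖)) by positivity) fun m => ?_
  show ‖covDeriv C A ((GP C K Ω A msq a * RopP C K K₀ Ω A msq a ^ m) g) b‖ ≤ (2 ^ P.d * β) ^ m * ((P.mesh 0)⁻¹ * (2 * (Cst * ‖g‖)))
  have hw : ‖(GP C K Ω A msq a * RopP C K K₀ Ω A msq a ^ m) g‖ ≤ (2 ^ P.d * β) ^ m * (Cst * ‖g‖) := by
    rw [Module.End.mul_apply]
    calc ‖GP C K Ω A msq a ((RopP C K K₀ Ω A msq a ^ m) g)‖ ≤ Cst * ‖(RopP C K K₀ Ω A msq a ^ m) g‖ := hGP _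
      _ ≤ Cst * ((2 ^ P.d * β) ^ m * ‖g‖) := mul_le_mul_of_nonneg_left (norm_RopP_pow_le C Ω A hK hK₀ hK₀8 hβ h0 m g) hC
      _ = (2 ^ P.d * β) ^ m * (Cst * ‖g‖) := by ring
  refine (norm_covDeriv_le C A _ b).trans ?_
  have ht := (norm_le_pi_norm ((GP C K Ω A msq a * RopP C K K₀ Ω A msq a ^ m) g) b.tgt).trans hw
  have hs := (norm_le_pi_norm ((GP C K Ω A msq a * RopP C K K₀ Ω A msq a ^ m) g) b.src).trans hw
  calc (P.mesh 0)⁻¹ * (‖(GP C K Ω A msq a * RopP C K K₀ Ω A msq a ^ m) g b.tgt‖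
        + ‖(GP C K Ω A msq a * RopP C K K₀ Ω A msq a ^ m) g b.src‖)
      ≤ (P.mesh 0)⁻¹ * (2 * ((2 ^ P.d * β) ^ m * (Cst * ‖g‖))) := mul_le_mul_of_nonneg_left (by linarith) (inv_nonneg.2 hm.le)
    _ = (2 ^ P.d * β) ^ m * ((P.mesh 0)⁻¹ * (2 * (Cst * ‖g‖))) := by ring

set_option maxHeartbeats 800000 in
/-- **THE WALK EXPANSION (2.12)–(2.22) FOR A REGION WHOSE EVERY PIECE CARRIES THE SUP LETTERS — NO `R₀`** («for rectangular
parallelepipeds … we can apply Lemma 2.2 to all operators in it»): r01's abstract chain `lp_walk_bound_rem_exp` on the projected letters of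
`B1TorusRegionRop` with ALL labels good and the constant grading `‖·‖_∞` (`n₀ = 1`, `V = 1`): for a subadditive probe `Φ` with `Φ(0) ≤ 0`
vanishing on the letters `a_ig` of the windows not seeing the finite probe set `X₀`, `Φ(a_ig) ≤ γ‖g‖_∞` and `‖b_jψ‖_∞ ≤ β‖ψ‖_∞` on `Ω`-supported
inputs at EVERY label, `3^dβ ≤ e^{−1}`, `f` vanishing within `Dist` of `X₀` and the remainder hypothesis:
`Φ(G^ε_K(Ω, A)1_Ωf) ≤ 2|X₀|2^d·γ·exp(−(Dist − 4rS)/(2M))·‖f‖_∞`.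
[cite: Balaban1983RegularityDecay, (2.18)–(2.22) pp.578–579, p.579 L25–28] [cite: Balaban1982Higgs1, Prop. 2.1 p.611 l.1–2] -/
theorem chain_allgood_of_inputs_probe (hK : K ≤ P.K) (hK₀ : K₀ ∣ P.M) (hK₀8 : 8 ≤ K₀)
    (hN3 : ∀ μ, 3 * half P K K₀ ≤ P.sitesPerDir 0 μ) (hΩ : IsBigBlockUnion K K₀ Ω) (hmsq : 0 < msq) (hak : 0 ≤ B1.aSeq a P.L K)
    {γ β : ℝ} (hγ : 0 ≤ γ) (hβ : 0 ≤ β) (hDβ : (3 : ℝ) ^ P.d * β ≤ Real.exp (-1))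
    {Φ : HiggsLattice.ScalarField P 0 N → ℝ} (hΦ0 : Φ 0 ≤ 0) (hΦadd : ∀ u v, Φ (u + v) ≤ Φ u + Φ v)
    (X₀ : Finset (HiggsLattice.Site P 0))
    (hΦloc : ∀ i : Lab P K K₀, (∀ x' ∈ X₀, ¬ Near K K₀ (rS P K K₀) i x') → ∀ g : HiggsLattice.ScalarField P 0 N,
      Φ (aOp C K K₀ Ω A msq a i g) ≤ 0)
    (hΦa : ∀ (i : Lab P K K₀) (g : HiggsLattice.ScalarField P 0 N), (∀ y, y ∉ Ω → g y = 0) →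
      Φ (aOp C K K₀ Ω A msq a i g) ≤ γ * ‖g‖)
    (h0 : ∀ (j : Lab P K K₀) (ψ : HiggsLattice.ScalarField P 0 N), (∀ y, y ∉ Ω → ψ y = 0) →
      ‖bOp C K K₀ Ω A msq a j ψ‖ ≤ β * ‖ψ‖)
    (f : HiggsLattice.ScalarField P 0 N) {Dist : ℕ} (hf : ∀ x' ∈ X₀, ∀ y, f y ≠ 0 → Dist ≤ HiggsLattice.Site.tdist x' y)
    (hrem : ∀ ε' : ℝ, 0 < ε' → ∃ m : ℕ, Φ ((GP C K Ω A msq a * RopP C K K₀ Ω A msq a ^ m) f) ≤ ε') :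
    Φ (propagatorK C Ω A msq a K (chi Ω • f))
      ≤ 2 * (X₀.card * 2 ^ P.d) * γ * Real.exp (-(((Dist : ℝ) - 4 * rS P K K₀) / (2 * half P K K₀))) * ‖f‖ := by
  classical
  have hK₀' : 1 ≤ K₀ := le_trans (by norm_num) hK₀8
  have hh : 0 < (half P K K₀ : ℝ) := by exact_mod_cast half_pos hK₀'
  have hΩb := blockSat_of_isBigBlockUnion (K₀ := K₀) hK hΩ
  -- the sets `S₀`, `S₁` and the separation count `N`
  set S₀ : Finset (Lab P K K₀) := Finset.univ.filter fun i => ∃ x' ∈ X₀, Near K K₀ (rS P K K₀) i x' with hS₀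
  set S₁ : Finset (Lab P K K₀) := Finset.univ.filter fun l => ∃ y, f y ≠ 0 ∧ Near K K₀ (rS P K K₀) l y with hS₁
  set Nn : ℕ := ⌈((Dist : ℝ) - 4 * rS P K K₀) / (2 * half P K K₀)⌉₊ with hNn
  have hS₀card : (S₀.card : ℝ) ≤ X₀.card * 2 ^ P.d := by
    have hsub : S₀ ⊆ X₀.biUnion fun x' => Finset.univ.filter fun i : Lab P K K₀ => Near K K₀ (rS P K K₀) i x' := by
      intro i hi
      rw [hS₀, Finset.mem_filter] at hi
      obtain ⟨x', hx', hnear⟩ := hi.2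
      rw [Finset.mem_biUnion]
      exact ⟨x', hx', by rw [Finset.mem_filter]; exact ⟨Finset.mem_univ _, hnear⟩⟩
    have h1 := (Finset.card_le_card hsub).trans Finset.card_biUnion_le
    have h2 : ∑ x' ∈ X₀, (Finset.univ.filter fun i : Lab P K K₀ => Near K K₀ (rS P K K₀) i x').card ≤ ∑ _x' ∈ X₀, 2 ^ P.d :=
      Finset.sum_le_sum fun x' _ => card_filter_near_rS_le hK hK₀ hK₀8 x'
    rw [Finset.sum_const, smul_eq_mul] at h2
    exact_mod_cast h1.trans h2
  -- the single sup letter of `R` (every label)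
  have hb : ∀ (j : Lab P K K₀) (g : HiggsLattice.ScalarField P 0 N), ‖bOpP C K K₀ Ω A msq a j g‖ ≤ β * ‖g‖ := fun j g => by
    rw [bOpP_apply]
    exact (h0 j _ (chi_smul_supported Ω g)).trans (mul_le_mul_of_nonneg_left (norm_chi_smul_le Ω g) hβ)
  -- the abstract chain, all labels good, constant grading
  have hmain := lp_walk_bound_rem_exp (R := Module.End ℝ (HiggsLattice.ScalarField P 0 N)) (E := HiggsLattice.ScalarField P 0 N)
    (LAdj K K₀) (a := aOpP C K K₀ Ω A msq a) (b := bOpP C K K₀ Ω A msq a)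
    (G := GP C K Ω A msq a) (G₀ := G0P C K K₀ Ω A msq a) (Rop := RopP C K K₀ Ω A msq a) (f := f)
    (Φ := Φ) (nrm := fun (_ : ℕ) (g : HiggsLattice.ScalarField P 0 N) => ‖g‖) (good := fun _ : Lab P K K₀ => True)
    (S₀ := S₀) (S₁ := S₁) (c₁ := γ) (β := β) (r := (Nn : ℝ) + 2) (D := 3 ^ P.d) (N := Nn) (n₀ := 1) (V := 1)
    G0P_eq_sum RopP_eq_sum (GP_eq C Ω A hK hK₀ hK₀8 hN3 hΩb hmsq hak)
    hrem
    (fun i l hil => aOpP_mul_bOpP_eq_zero C Ω A hK hK₀ hK₀8 hN3 hΩb hmsq hak i l fun y hy =>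
      hil (ladj_of_near_near hK hK₀ hK₀8 hy.1 hy.2))
    (fun i l hil => bOpP_mul_bOpP_eq_zero C Ω A hK hK₀ hK₀8 hN3 hΩb hmsq hak i l fun y hy =>
      hil (ladj_of_near_near hK hK₀ hK₀8 hy.1 hy.2))
    hΦ0 hΦadd
    (fun i hi g => hΦloc i (fun x' hx' hn => hi (by rw [hS₀, Finset.mem_filter]; exact ⟨Finset.mem_univ _, x', hx', hn⟩)) _)
    (fun i hi => by
      show aOpP C K K₀ Ω A msq a i f = 0
      rw [aOpP_apply]
      refine aOp_apply_eq_zero_of_support C Ω A msq a hK hK₀ hK₀8 i _ fun z hz hzn => hi ?_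
      rw [hS₁, Finset.mem_filter]
      refine ⟨Finset.mem_univ _, z, fun hf0 => hz ?_, hzn⟩
      rw [chi_smul_apply]; split_ifs <;> simp [hf0])
    (fun i hi => by
      show bOpP C K K₀ Ω A msq a i f = 0
      rw [bOpP_apply]
      refine bOp_apply_eq_zero_of_support C Ω A msq a hK hK₀ hK₀8 i _ fun z hz hzn => hi ?_
      rw [hS₁, Finset.mem_filter]
      refine ⟨Finset.mem_univ _, z, fun hf0 => hz ?_, hzn⟩
      rw [chi_smul_apply]; split_ifs <;> simp [hf0])
    hγ
    (fun i _ g => by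
      show Φ (aOpP C K K₀ Ω A msq a i g) ≤ γ * ‖g‖
      rw [aOpP_apply]
      exact (hΦa i _ (chi_smul_supported Ω g)).trans (mul_le_mul_of_nonneg_left (norm_chi_smul_le Ω g) hγ))
    hβ
    (fun j _ i _ _ g => hb j g)
    (fun j g => hb j g)
    (fun j _ g => hb j g)
    le_rfl (le_of_eq (one_mul _).symm) (norm_nonneg f)
    (fun _ _ _ _ _ _ _ => trivial)
    (fun j => card_filter_ladj_le hK hK₀ hK₀' j)
    (by rw [Nat.cast_pow, Nat.cast_ofNat]; exact hDβ)
    (fun n i hi ys hw hl => by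
      rw [hS₀, Finset.mem_filter] at hi
      rw [hS₁, Finset.mem_filter] at hl
      obtain ⟨x', hx', hnear⟩ := hi.2
      obtain ⟨y, hy, hyn⟩ := hl.2
      have hd := tdist_le_of_walk_near hK hK₀ hw hnear hyn
      have hD := hf x' hx' y hy
      rw [hNn]
      refine Nat.ceil_le.2 ?_
      rw [div_le_iff₀ (by positivity)]
      have : ((Dist : ℕ) : ℝ) ≤ 4 * rS P K K₀ + 2 * half P K K₀ * n := by exact_mod_cast hD.trans hd
      linarith)
    (by linarith)
  -- read off the bound
  have hΦ : Φ (propagatorK C Ω A msq a K (chi Ω • f)) = Φ (GP C K Ω A msq a • f) := rfl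
  rw [hΦ]
  refine hmain.trans ?_
  have hexp : Real.exp 2 * Real.exp (-((Nn : ℝ) + 2)) ≤ Real.exp (-(((Dist : ℝ) - 4 * rS P K K₀) / (2 * half P K K₀))) := by
    rw [← Real.exp_add]
    refine Real.exp_le_exp.2 ?_
    have := Nat.le_ceil (((Dist : ℝ) - 4 * rS P K K₀) / (2 * half P K K₀))
    rw [← hNn] at this
    linarith
  have hf0 : 0 ≤ ‖f‖ := norm_nonneg f
  calc 2 * (S₀.card : ℝ) * γ * 1 * Real.exp 2 * Real.exp (-((Nn : ℝ) + 2)) * ‖f‖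
      = (S₀.card : ℝ) * (Real.exp 2 * Real.exp (-((Nn : ℝ) + 2))) * (2 * γ * ‖f‖) := by ring
    _ ≤ (X₀.card * 2 ^ P.d) * Real.exp (-(((Dist : ℝ) - 4 * rS P K K₀) / (2 * half P K K₀))) * (2 * γ * ‖f‖) :=
        mul_le_mul_of_nonneg_right (mul_le_mul hS₀card hexp (by positivity) (by positivity)) (by positivity)
    _ = 2 * (X₀.card * 2 ^ P.d) * γ * Real.exp (-(((Dist : ℝ) - 4 * rS P K K₀) / (2 * half P K K₀))) * ‖f‖ := by ring

end Chain

/-! ## §3 The letters at EVERY label of a cell-product box: «we can apply Lemma 2.2 to all operators in it» -/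

section Letters

variable {K K₀ : ℕ}

/-- **(2.23) ON THE SITES OF A SUB-BOX ⇒ THE CHART-FORM REGULARITY AT THE SUB-BOX** (the transcribed field is read at `toT y ∈ boxT`).
[cite: Balaban1982Higgs1, Prop. 2.1 (2.23) p.610] -/
theorem abs_acT_sub_le_of_reg_on_boxT (hK : K ≤ P.K) (hK₀ : K₀ ∣ P.M) (hK₀8 : 8 ≤ K₀) (C : ChargeData N) (j : Lab P K K₀)
    {Mb : Fin (dd P + 1) → ℕ} (hMb : ∀ i, Mb i ≤ 2 * K₀)
    (A : HiggsLattice.VecField P 0) {ec creg β : ℝ} (hec : 0 < ec)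
    (hreg : ∀ x ∈ boxT K K₀ j Mb, ∀ μ ν : Fin P.d,
      P.mesh K * |C.e| / ec * |A ⟨x.shift μ, ν⟩ - A ⟨x, ν⟩| ≤ creg * ec ^ (β - 1) / (P.L : ℝ) ^ K) :
    ∀ y ∈ Box (dd P) (P.L - 1) K Mb, ∀ i i' : Fin (dd P + 1),
      |acT K K₀ j ((((P.L - 1 + 1) ^ K : ℕ) : ℝ) * P.mesh 0 * C.e / ec) A (y + e1 i) i'
        - acT K K₀ j ((((P.L - 1 + 1) ^ K : ℕ) : ℝ) * P.mesh 0 * C.e / ec) A y i'|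
        ≤ creg * ec ^ (β - 1) / ((P.L - 1 + 1) ^ K : ℕ) := by
  intro y hy i i'
  have hnR : ((((P.L - 1 + 1) ^ K : ℕ)) : ℝ) = (P.L : ℝ) ^ K := by rw [predL_succ, Nat.cast_pow]
  unfold acT
  rw [toT_add_e1, ← mul_sub, abs_mul, abs_chartScale C K hec, hnR]
  exact hreg _ (toT_mem_boxT hK hK₀ hK₀8 j hMb hy) _ _

set_option maxHeartbeats 1600000 in
/-- **THE LETTERS OF THE RANDOM WALK AT EVERY LABEL OF A CELL-PRODUCT BOX `Ω = cellBox S`, UNDER (2.23) ON `Ω`** («all □_j in the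
representation (2.13) are cubes and we can apply Lemma 2.2 to all operators in it»).  For `d0, ℓ0`, `a > 0`, `m² > 0`, `m²₊`, `c ≥ 0`,
`β > 0`: constants `C_g, C_m > 0` and, for every `K₀ ≥ 8`, a threshold `e₁ > 0` such that for every torus of the carrier (`dd P = d0`,
`L − 1 = ℓ0`), `1 ≤ K ≤ K_P`, `K₀ ∣ M_P`, `3M ≤ |T_ε|_μ`, `m²(L^Kε)² ≤ m²₊`, every `S`, `A`, `0 < e_K ≤ e₁` with (2.23) on `Ω`, EVERY label `j`
and every `Ω`-supported `ψ`:  the value letter `‖G_j(h_jψ)‖_∞ ≤ C_g(L^Kε)²‖ψ‖_∞`, the derivative letter `‖D^ε_A(h_jG_j(h_jψ))(b)‖ ≤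
C_g(L^Kε)‖ψ‖_∞` at every bond `b = ⟨x, x + e_μ⟩` with both ends in `Ω`, and the `R`-letter `‖b_jψ‖_∞ ≤ (C_m/K₀)‖ψ‖_∞`.  At an interior window
(`□_j ⊆ Ω`) these are gen 8's `cube_inputs` and gen 12's `cube_deriv_sup` in the window's own gauge «Ã_j = A₀ + θ_jA′»; at a boundary piece
— a sub-box of the neighbouring chart (`piece_cellBox_eq_boxT`) — they are `B1TorusSubBoxOp.subbox_inputs` at the raw field «Ã_j = A» with
the Leibniz rule and «|∂^ηh_j| ≤ O(M⁻¹)» (gen 10) for the derivative letter; an empty piece contributes nothing.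
[cite: Balaban1983RegularityDecay, §2 p.575, Lemma 2.2 (2.17) p.578, (2.20) p.578, p.579 L25–28] [cite: Balaban1982Higgs1, Prop. 2.1 (2.23) p.610, p.611 l.1–2] -/
theorem box_letters (C : ChargeData N) (d0 ℓ0 : ℕ) (hℓ0 : 1 ≤ ℓ0) {a : ℝ} (ha : 0 < a) {msq : ℝ} (hmsq : 0 < msq) (m2plus : ℝ)
    (creg β : ℝ) (hcreg : 0 ≤ creg) (hβ : 0 < β) :
    ∃ Cg Cm : ℝ, 0 < Cg ∧ 0 < Cm ∧ ∀ K₀ : ℕ, 8 ≤ K₀ → ∃ e₁ : ℝ, 0 < e₁ ∧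
      ∀ (P : HiggsLattice.Params), dd P = d0 → P.L - 1 = ℓ0 → ∀ {K : ℕ}, 1 ≤ K → K ≤ P.K → K₀ ∣ P.M →
      (∀ μ, 3 * half P K K₀ ≤ P.sitesPerDir 0 μ) → msq * P.mesh K ^ 2 ≤ m2plus →
      ∀ (S : Fin P.d → Finset ℕ) (A : HiggsLattice.VecField P 0) {ec : ℝ}, 0 < ec → ec ≤ e₁ →
      (∀ z ∈ cellBox K K₀ S, ∀ μ ν : Fin P.d,
          P.mesh K * |C.e| / ec * |A ⟨z.shift μ, ν⟩ - A ⟨z, ν⟩| ≤ creg * ec ^ (β - 1) / (P.L : ℝ) ^ K) →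
      ∀ (j : Lab P K K₀) (ψ : HiggsLattice.ScalarField P 0 N), (∀ y, y ∉ cellBox K K₀ S → ψ y = 0) →
        ‖Gloc C K K₀ (cellBox K K₀ S) A msq a j (hTor K K₀ j • ψ)‖ ≤ Cg * P.mesh K ^ 2 * ‖ψ‖ ∧
        (∀ (x : HiggsLattice.Site P 0) (μ : Fin P.d), x ∈ cellBox K K₀ S → x.shift μ ∈ cellBox K K₀ S →
          ‖covDeriv C A (aOp C K K₀ (cellBox K K₀ S) A msq a j ψ) ⟨x, μ⟩‖ ≤ Cg * P.mesh K * ‖ψ‖) ∧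
        ‖bOp C K K₀ (cellBox K K₀ S) A msq a j ψ‖ ≤ Cm / K₀ * ‖ψ‖ := by
  obtain ⟨Cγ, Cβ, hCγ, hCβ, hcube⟩ := cube_inputs C d0 ℓ0 hℓ0 a a m2plus ha
  obtain ⟨Cγ2, Cδ, CT, hCγ2, hCδ, hCT, hder⟩ := cube_deriv_sup C d0 ℓ0 hℓ0 ha hmsq m2plus creg β hcreg hβ
  obtain ⟨Cγ', Cβ', hCγ', hCβ', hsub⟩ := subbox_inputs C d0 ℓ0 hℓ0 a a m2plus ha
  have hD1 := D1_nonneg contDiff_hprof hasCompactSupport_hprof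
  have hD2 := D2_nonneg contDiff_hprof hasCompactSupport_hprof
  refine ⟨max (max Cγ Cγ') (max CT (Cγ' + ((d0 : ℝ) + 1) * (D1 hprof + D2 hprof) / 8 * Cγ')), max Cβ Cβ',
    lt_of_lt_of_le hCγ ((le_max_left _ _).trans (le_max_left _ _)), lt_of_lt_of_le hCβ (le_max_left _ _), fun K₀ hK₀8 => ?_⟩
  obtain ⟨e₁, he₁, hcubeK⟩ := hcube creg β hcreg hβ K₀ hK₀8
  obtain ⟨e₂, he₂, hderK⟩ := hder K₀ hK₀8
  obtain ⟨e₃, he₃, hsubK⟩ := hsub creg β hcreg hβ K₀ hK₀8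
  refine ⟨min e₁ (min e₂ e₃), lt_min he₁ (lt_min he₂ he₃), ?_⟩
  intro P hPd hPL K hK1 hK hK₀M hN3 hcap S A ec hec hle hreg j ψ hψ
  have hec1 : ec ≤ e₁ := hle.trans (min_le_left _ _)
  have hec2 : ec ≤ e₂ := hle.trans ((min_le_right _ _).trans (min_le_left _ _))
  have hec3 : ec ≤ e₃ := hle.trans ((min_le_right _ _).trans (min_le_right _ _))
  have hK₀' : 1 ≤ K₀ := le_trans (by norm_num) hK₀8
  have hK₀r : (0 : ℝ) < K₀ := by exact_mod_cast hK₀'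
  have hmesh : 0 < P.mesh K := P.mesh_pos K
  have hψ0 : 0 ≤ ‖ψ‖ := norm_nonneg _
  -- the constants
  have hg1 : Cγ ≤ max (max Cγ Cγ') (max CT (Cγ' + ((d0 : ℝ) + 1) * (D1 hprof + D2 hprof) / 8 * Cγ')) :=
    (le_max_left _ _).trans (le_max_left _ _)
  have hg2 : Cγ' ≤ max (max Cγ Cγ') (max CT (Cγ' + ((d0 : ℝ) + 1) * (D1 hprof + D2 hprof) / 8 * Cγ')) :=
    (le_max_right _ _).trans (le_max_left _ _)
  have hg3 : CT ≤ max (max Cγ Cγ') (max CT (Cγ' + ((d0 : ℝ) + 1) * (D1 hprof + D2 hprof) / 8 * Cγ')) :=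
    (le_max_left _ _).trans (le_max_right _ _)
  have hg4 : Cγ' + ((d0 : ℝ) + 1) * (D1 hprof + D2 hprof) / 8 * Cγ'
      ≤ max (max Cγ Cγ') (max CT (Cγ' + ((d0 : ℝ) + 1) * (D1 hprof + D2 hprof) / 8 * Cγ')) :=
    (le_max_right _ _).trans (le_max_right _ _)
  have hm1 : Cβ / K₀ ≤ max Cβ Cβ' / K₀ := div_le_div_of_nonneg_right (le_max_left _ _) hK₀r.le
  have hm2 : Cβ' / K₀ ≤ max Cβ Cβ' / K₀ := div_le_div_of_nonneg_right (le_max_right _ _) hK₀r.le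
  by_cases hj : cube K K₀ j ⊆ cellBox K K₀ S
  · -- AN INTERIOR WINDOW: gen 8's cube inputs and gen 12's derivative letters in the window's own gauge, (2.23) read on the window
    have hregj : ∀ z ∈ cube K K₀ j, ∀ μ ν : Fin P.d,
        P.mesh K * |C.e| / ec * |A ⟨z.shift μ, ν⟩ - A ⟨z, ν⟩| ≤ creg * ec ^ (β - 1) / (P.L : ℝ) ^ K :=
      fun z hz μ ν => hreg z (hj hz) μ ν
    have h17 := abs_acT_sub_le_of_reg_on hK hK₀M hK₀' C j A hec hregj
    have hcj := hcubeK P hPd hPL K hK1 hK hK₀M hN3 a msq le_rfl le_rfl hmsq hcap j A ec hec hec1 h17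
    have hdj := hderK P hPd hPL hK1 hK hK₀M hN3 hcap j A hec hec2 hregj
    refine ⟨?_, ?_, ?_⟩
    · rw [Gloc_of_good C (cellBox K K₀ S) A msq a hj]
      exact (hcj.1 ψ).trans (mul_le_mul_of_nonneg_right (mul_le_mul_of_nonneg_right hg1 (by positivity)) hψ0)
    · intro x μ _ _
      rw [aOp_apply, Gloc_of_good C (cellBox K K₀ S) A msq a hj]
      exact ((norm_le_pi_norm (fun b => covDeriv C A (hTor K K₀ j • propagatorK C (cube K K₀ j) (cubeVec K K₀ j A) msq a K
        (hTor K K₀ j • ψ)) b : HiggsLattice.PBond P 0 → EuclideanSpace ℝ (Fin N)) ⟨x, μ⟩).trans (hdj.2.2 ψ)).trans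
        (mul_le_mul_of_nonneg_right (mul_le_mul_of_nonneg_right hg3 hmesh.le) hψ0)
    · rw [bOp_of_good C (cellBox K K₀ S) A msq a hj ψ, norm_neg]
      exact (hcj.2 ψ).trans (mul_le_mul_of_nonneg_right hm1 hψ0)
  · by_cases hall : ∀ μ, loCell j μ ∈ S μ ∨ hiCell j μ ∈ S μ
    · -- A BOUNDARY PIECE «Ã_j = A»: a sub-box of the neighbouring chart
      have hpc := piece_cellBox_eq_boxT hK hK₀M hK₀' hN3 S j hall
      have hreg' : ∀ z ∈ boxT K K₀ (jB K K₀ hK hK₀M hK₀' S j) (MbB K K₀ S j), ∀ μ ν : Fin P.d,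
          P.mesh K * |C.e| / ec * |A ⟨z.shift μ, ν⟩ - A ⟨z, ν⟩| ≤ creg * ec ^ (β - 1) / (P.L : ℝ) ^ K := by
        intro z hz μ ν
        rw [← hpc] at hz
        exact hreg z (piece_subset _ _ hz) μ ν
      have h17 := abs_acT_sub_le_of_reg_on_boxT hK hK₀M hK₀8 C (jB K K₀ hK hK₀M hK₀' S j) (MbB_le S j) A hec hreg'
      have hsupp : ∀ y, y ∉ boxT K K₀ (jB K K₀ hK hK₀M hK₀' S j) (MbB K K₀ S j) → (hTor K K₀ j • ψ) y = 0 := by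
        intro y hy
        rw [← hpc] at hy
        exact hTor_smul_supported_piece hK hK₀M hK₀8 (cellBox K K₀ S) j hψ y hy
      have hsj := hsubK P hPd hPL K hK1 hK hK₀M hN3 a msq le_rfl le_rfl hmsq hcap (jB K K₀ hK hK₀M hK₀' S j) (MbB K K₀ S j)
        (one_le_MbB hK₀' S j) (MbB_le S j) (dvd_MbB S j) (hTor K K₀ j) (jlB K K₀ S j) (hTor_toT_jB hK hK₀M hK₀' S j) A ec hec
        hec3 h17 ψ hsupp
      have hG : Gloc C K K₀ (cellBox K K₀ S) A msq a j
          = propagatorK C (boxT K K₀ (jB K K₀ hK hK₀M hK₀' S j) (MbB K K₀ S j)) A msq a K := by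
        unfold Gloc; rw [fld_of_bad hj, hpc]
      have hH : Hloc C K K₀ (cellBox K K₀ S) A msq a j
          = covOpK C (boxT K K₀ (jB K K₀ hK hK₀M hK₀' S j) (MbB K K₀ S j)) A msq a K := by
        unfold Hloc; rw [fld_of_bad hj, hpc]
      refine ⟨?_, ?_, ?_⟩
      · rw [hG]; exact hsj.1.trans (mul_le_mul_of_nonneg_right (mul_le_mul_of_nonneg_right hg2 (by positivity)) hψ0)
      · -- the derivative letter: Leibniz, `|h_j| ≤ 1`, «|∂^ηh_j| ≤ O(M⁻¹)», `|U| = 1`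
        intro x μ hxΩ hsΩ
        rw [aOp_apply, hG, covDeriv_hsmul]
        have hu0 : ∀ y, ‖propagatorK C (boxT K K₀ (jB K K₀ hK hK₀M hK₀' S j) (MbB K K₀ S j)) A msq a K (hTor K K₀ j • ψ) y‖
            ≤ Cγ' * P.mesh K ^ 2 * ‖ψ‖ := fun y => (norm_le_pi_norm _ y).trans hsj.1
        have hrhs : Cγ' * P.mesh K * ‖ψ‖ + ((dd P : ℝ) + 1) * (D1 hprof + D2 hprof) / K₀ * (P.mesh K)⁻¹ * (Cγ' * P.mesh K ^ 2 * ‖ψ‖)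
            ≤ max (max Cγ Cγ') (max CT (Cγ' + ((d0 : ℝ) + 1) * (D1 hprof + D2 hprof) / 8 * Cγ')) * P.mesh K * ‖ψ‖ := by
          rw [hPd]
          have e : ((d0 : ℝ) + 1) * (D1 hprof + D2 hprof) / K₀ * (P.mesh K)⁻¹ * (Cγ' * P.mesh K ^ 2 * ‖ψ‖)
              = ((d0 : ℝ) + 1) * (D1 hprof + D2 hprof) / K₀ * Cγ' * (P.mesh K * ‖ψ‖) := by
            field_simp
          rw [e]
          have h8 : ((d0 : ℝ) + 1) * (D1 hprof + D2 hprof) / K₀ ≤ ((d0 : ℝ) + 1) * (D1 hprof + D2 hprof) / 8 :=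
            div_le_div_of_nonneg_left (by positivity) (by norm_num) (by exact_mod_cast hK₀8)
          calc Cγ' * P.mesh K * ‖ψ‖ + ((d0 : ℝ) + 1) * (D1 hprof + D2 hprof) / K₀ * Cγ' * (P.mesh K * ‖ψ‖)
              ≤ Cγ' * P.mesh K * ‖ψ‖ + ((d0 : ℝ) + 1) * (D1 hprof + D2 hprof) / 8 * Cγ' * (P.mesh K * ‖ψ‖) := by
                gcongr
            _ = (Cγ' + ((d0 : ℝ) + 1) * (D1 hprof + D2 hprof) / 8 * Cγ') * P.mesh K * ‖ψ‖ := by ring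
            _ ≤ max (max Cγ Cγ') (max CT (Cγ' + ((d0 : ℝ) + 1) * (D1 hprof + D2 hprof) / 8 * Cγ')) * P.mesh K * ‖ψ‖ :=
                mul_le_mul_of_nonneg_right (mul_le_mul_of_nonneg_right hg4 hmesh.le) hψ0
        refine le_trans ?_ hrhs
        by_cases hne : hTor K K₀ j x ≠ 0 ∨ hTor K K₀ j (x.shift μ) ≠ 0
        · have hx : Near K K₀ (rS P K K₀) j x :=
            hne.elim (near_rS_of_hTor_ne_zero hK hK₀M hK₀8) (near_rS_of_hTor_shift_ne_zero hK hK₀M hK₀8)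
          obtain ⟨hxc, hsc, -⟩ := mem_cube_of_near hK₀8 hx μ
          have hxb : x ∈ boxT K K₀ (jB K K₀ hK hK₀M hK₀' S j) (MbB K K₀ S j) := by rw [← hpc, mem_piece]; exact ⟨hxΩ, hxc⟩
          have hsb : x.shift μ ∈ boxT K K₀ (jB K K₀ hK hK₀M hK₀' S j) (MbB K K₀ S j) := by rw [← hpc, mem_piece]; exact ⟨hsΩ, hsc⟩
          refine (norm_add_le _ _).trans (add_le_add ?_ ?_)
          · rw [norm_smul, Real.norm_eq_abs]
            calc |hTor K K₀ j x| * ‖covDeriv C A (propagatorK C (boxT K K₀ (jB K K₀ hK hK₀M hK₀' S j) (MbB K K₀ S j)) A msq a K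
                    (hTor K K₀ j • ψ)) ⟨x, μ⟩‖ ≤ 1 * (Cγ' * P.mesh K * ‖ψ‖) :=
                  mul_le_mul (abs_hTor_le_one hK hK₀M hK₀' j x) (hsj.2.1 x μ hxb hsb) (norm_nonneg _) zero_le_one
              _ = Cγ' * P.mesh K * ‖ψ‖ := one_mul _
          · rw [norm_smul, Real.norm_eq_abs, norm_U_apply]
            exact mul_le_mul (abs_sderiv_hTor_le hK hK₀M hK₀8 hN3 j ⟨x, μ⟩) (hu0 _) (norm_nonneg _) (by positivity)
        · push Not at hne
          have h0 : sderiv (hTor K K₀ j) (⟨x, μ⟩ : HiggsLattice.PBond P 0) = 0 := by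
            unfold sderiv
            rw [show (HiggsLattice.PBond.tgt ⟨x, μ⟩ : HiggsLattice.Site P 0) = x.shift μ from rfl, hne.2]
            simp [hne.1]
          rw [hne.1, h0, zero_smul, zero_smul, add_zero, norm_zero]
          positivity
      · rw [bOp_apply, hH, hG, norm_neg]
        exact hsj.2.2.trans (mul_le_mul_of_nonneg_right hm2 hψ0)
    · -- AN EMPTY PIECE: `h_jψ = 0`
      obtain ⟨μ, hμ⟩ := not_forall.1 hall
      obtain ⟨hlo, hhi⟩ := not_or.1 hμ
      have hempty := piece_cellBox_empty hK hK₀M hK₀' S j hlo hhi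
      have h0 : hTor K K₀ j • ψ = 0 := by
        funext y
        exact hTor_smul_supported_piece hK hK₀M hK₀8 (cellBox K K₀ S) j hψ y (hempty y)
      refine ⟨?_, ?_, ?_⟩
      · rw [h0, map_zero, norm_zero]; positivity
      · intro x μ' _ _
        rw [aOp_apply, h0, map_zero, smul_zero, covDeriv_zero', norm_zero]; positivity
      · have : bOp C K K₀ (cellBox K K₀ S) A msq a j ψ = 0 := by
          rw [bOp_apply, h0, map_zero, smul_zero, map_zero, smul_zero, sub_zero, neg_zero]
        rw [this, norm_zero]; positivity

end Letters

/-! ## §4 Prop. 2.1 (2.25), value and derivative members, for boxes of large blocks WITHOUT `R₀` -/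

section Main

set_option maxHeartbeats 800000 in
/-- **PROP. 2.1 (2.25), VALUE MEMBER, FOR BOXES OF LARGE BLOCKS `Ω ⊂ T_ε` WITHOUT THE RESTRICTION `dist(x, Ωᶜ) ≥ R₀`, AT EVERY
(2.23)-REGULAR VECTOR FIELD** — the sentence [Balaban1982Higgs1] p. 611 l.1–2 «For some simple sets Ω, e.g. for rectangular parallelepipeds,
the inequalities hold without any restrictions on the points x, x′» (= [Balaban1983RegularityDecay] p. 579 «if Ω is a rectangular
parallelepiped, then all □_j in the representation (2.13) are cubes and we can apply Lemma 2.2 to all operators in it») ON THE CARRIER.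
For `d ≥ 1`, `L ≥ 2`, `a > 0`, `m² > 0`, `N`, `(e, q)`, a mesh cap `ε₀` and a regularity pair `c ≥ 0`, `β > 0`: constants `c₀ > 0`, `K₀min`,
and for every cube size `K₀ ≥ K₀min` a threshold `e₁ > 0` such that on EVERY torus of the carrier with `K₀ ∣ M`, at every level
`1 ≤ K ≤ K_P` with `3·L^KK₀ ≤ |T_ε|_μ` and `L^Kε ≤ ε₀`, for EVERY cell-product box of large blocks `Ω = cellBox S`, EVERY vector field `A`
and `0 < e_K ≤ e₁` with (2.23) ON `Ω` in the form `(L^Kε|e|/e_K)|A_ν(z + εe_μ) − A_ν(z)| ≤ c·e_K^{β−1}/L^K` (`z ∈ Ω`), EVERY site `x`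
(no `R₀`), every `g` supported in a `K`-block with `‖g‖_∞ ≤ M′` vanishing at the sites within lattice distance `< D` of `x` (`D ≥ 0`):
`‖(G^ε_K(Ω, A)1_Ωg)(x)‖ ≤ c₀(L^Kε)²·exp(−D/(2K₀L^K))·M′`.  Proof = `chain_allgood_of_inputs_probe` with the value probe at `X₀ = {x}` fed by
`box_letters`; `3^d·C_m/K₀ ≤ e^{−1}` for `K₀ ≥ K₀min`; the tail from the sup letters.
[cite: Balaban1982Higgs1, Prop. 2.1 (2.23), (2.25) p.610, p.611 l.1–2] [cite: Balaban1983RegularityDecay, Theorem (1.10) p.573; (2.18)–(2.22) pp.578–579; p.579 L25–28] -/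
theorem norm_propagatorK_box_reg_decay (d L : ℕ) (hd : 1 ≤ d) (hL : 2 ≤ L) {a : ℝ} (ha : 0 < a) {msq : ℝ} (hmsq : 0 < msq)
    (N : ℕ) (C : ChargeData N) (ε₀ : ℝ) (creg β : ℝ) (hcreg : 0 ≤ creg) (hβ : 0 < β) :
    ∃ c₀ : ℝ, 0 < c₀ ∧ ∃ K₀min : ℕ, ∀ K₀ : ℕ, K₀min ≤ K₀ → ∃ e₁ : ℝ, 0 < e₁ ∧
      ∀ (P : HiggsLattice.Params), P.d = d → P.L = L → K₀ ∣ P.M →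
      ∀ {K : ℕ}, 1 ≤ K → K ≤ P.K → (∀ μ, 3 * half P K K₀ ≤ P.sitesPerDir 0 μ) → P.mesh K ≤ ε₀ →
      ∀ (S : Fin P.d → Finset ℕ) (A : HiggsLattice.VecField P 0) {ec : ℝ}, 0 < ec → ec ≤ e₁ →
      (∀ z ∈ cellBox K K₀ S, ∀ μ ν : Fin P.d,
          P.mesh K * |C.e| / ec * |A ⟨z.shift μ, ν⟩ - A ⟨z, ν⟩| ≤ creg * ec ^ (β - 1) / (P.L : ℝ) ^ K) →
      ∀ (x y₀ : HiggsLattice.Site P 0) (g : HiggsLattice.ScalarField P 0 N) (M D : ℝ),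
          (∀ y, blockIter K y ≠ blockIter K y₀ → g y = 0) → (∀ y, ‖g y‖ ≤ M) → 0 ≤ D →
          (∀ z, g z ≠ 0 → D ≤ (HiggsLattice.Site.tdist x z : ℝ)) →
            ‖propagatorK C (cellBox K K₀ S) A msq a K (chi (cellBox K K₀ S) • g) x‖
              ≤ c₀ * P.mesh K ^ 2 * Real.exp (-(D / (2 * K₀ * (P.L : ℝ) ^ K))) * M := by
  have hℓ0 : 1 ≤ L - 1 := by omega
  obtain ⟨Cg, Cm, hCg, hCm, hL0⟩ := box_letters C (d - 1) (L - 1) hℓ0 ha hmsq (msq * ε₀ ^ 2) creg β hcreg hβ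
  refine ⟨2 * 2 ^ d * Cg * Real.exp (3 / 2), by positivity, max 8 ⌈(3 : ℝ) ^ d * Cm * Real.exp 1⌉₊, fun K₀ hK₀ => ?_⟩
  have hK₀8 : 8 ≤ K₀ := le_trans (le_max_left _ _) hK₀
  have hK₀r : (0 : ℝ) < K₀ := by exact_mod_cast lt_of_lt_of_le (by norm_num) hK₀8
  have hK₀C : (3 : ℝ) ^ d * Cm * Real.exp 1 ≤ K₀ := (Nat.le_ceil _).trans (by exact_mod_cast le_trans (le_max_right _ _) hK₀)
  obtain ⟨e₁, he₁, hLK⟩ := hL0 K₀ hK₀8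
  refine ⟨e₁, he₁, ?_⟩
  intro P hPd hPL hK₀M K hK1 hK hN3 hε S A ec hec hle hreg x y₀ g M D hg hgM hD0 hD
  subst hPd
  have hdd : dd P = P.d - 1 := rfl
  have hPL1 : P.L - 1 = L - 1 := by rw [hPL]
  have hL1 : 1 < P.L := by rw [hPL]; omega
  have hL1r : (1 : ℝ) < P.L := by exact_mod_cast hL1
  have hak : 0 ≤ B1.aSeq a P.L K := (B1.aSeq_pos ha hL1r hK1).le
  have hK₀' : 1 ≤ K₀ := le_trans (by norm_num) hK₀8
  have hmesh : 0 < P.mesh K := P.mesh_pos K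
  have hcap : msq * P.mesh K ^ 2 ≤ msq * ε₀ ^ 2 := mul_le_mul_of_nonneg_left (pow_le_pow_left₀ hmesh.le hε 2) hmsq.le
  have hM0 : 0 ≤ M := (norm_nonneg _).trans (hgM x)
  have hgn : ‖g‖ ≤ M := (pi_norm_le_iff_of_nonneg hM0).2 hgM
  have hletters := hLK P hdd hPL1 hK1 hK hK₀M hN3 hcap S A hec hle hreg
  -- the letter constant and its smallness
  have hβK0 : 0 ≤ Cm / K₀ := div_nonneg hCm.le hK₀r.le
  have hDβ : (3 : ℝ) ^ P.d * (Cm / K₀) ≤ Real.exp (-1) := by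
    rw [mul_div_assoc', div_le_iff₀ hK₀r]
    have h1 : Real.exp (-1) * Real.exp 1 = 1 := by rw [← Real.exp_add]; norm_num
    have h2 : (3 : ℝ) ^ P.d * Cm = (3 : ℝ) ^ P.d * Cm * Real.exp 1 * Real.exp (-1) := by
      rw [mul_assoc ((3 : ℝ) ^ P.d * Cm), mul_comm (Real.exp 1), h1, mul_one]
    rw [h2]
    exact mul_le_mul_of_nonneg_right hK₀C (Real.exp_pos _).le |>.trans_eq (mul_comm _ _)
  have hsmall : 2 ^ P.d * (Cm / K₀) < 1 := by
    have h3 : (2 : ℝ) ^ P.d ≤ 3 ^ P.d := pow_le_pow_left₀ (by norm_num) (by norm_num) _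
    have he : Real.exp (-1) < 1 := Real.exp_lt_one_iff.mpr (by norm_num)
    nlinarith [mul_le_mul_of_nonneg_right h3 hβK0]
  have hγK0 : 0 ≤ Cg * P.mesh K ^ 2 := by positivity
  -- the chain with the value probe at `x`
  have hmain := chain_allgood_of_inputs_probe C (cellBox K K₀ S) A hK hK₀M hK₀8 hN3 (isBigBlockUnion_cellBox S) hmsq hak
    (γ := Cg * P.mesh K ^ 2) (β := Cm / K₀) hγK0 hβK0 hDβ (Φ := fun w => ‖w x‖)
    (by simp) (fun u v => norm_add_le (u x) (v x)) {x}
    (fun i hi g' => by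
      show ‖aOp C K K₀ (cellBox K K₀ S) A msq a i g' x‖ ≤ 0
      rw [aOp_apply_eq_zero_off C (cellBox K K₀ S) A msq a hK hK₀M hK₀8 i g' (hi x (Finset.mem_singleton_self x)), norm_zero])
    (fun i g' hg' => by
      show ‖aOp C K K₀ (cellBox K K₀ S) A msq a i g' x‖ ≤ Cg * P.mesh K ^ 2 * ‖g'‖
      rw [aOp_apply, Pi.smul_apply', norm_smul]
      calc ‖hTor K K₀ i x‖ * ‖Gloc C K K₀ (cellBox K K₀ S) A msq a i (hTor K K₀ i • g') x‖
          ≤ 1 * (Cg * P.mesh K ^ 2 * ‖g'‖) :=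
            mul_le_mul (by rw [Real.norm_eq_abs]; exact abs_hTor_le_one hK hK₀M hK₀' i x)
              ((norm_le_pi_norm _ x).trans (hletters i g' hg').1) (norm_nonneg _) zero_le_one
        _ = Cg * P.mesh K ^ 2 * ‖g'‖ := one_mul _)
    (fun j ψ hψ => (hletters j ψ hψ).2.2)
    g (Dist := ⌈D⌉₊) (fun x' hx' y hy => by
      rw [Finset.mem_singleton] at hx'; rw [hx']; exact Nat.ceil_le.2 (hD y hy))
    (exists_value_tail_le C (cellBox K K₀ S) A hK hK₀M hK₀8 hβK0 hsmall (fun j ψ hψ => (hletters j ψ hψ).2.2) g x)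
  refine hmain.trans ?_
  -- the exponent: `(⌈D⌉ − 4rS)/(2M) ≥ D/(2K₀L^K) − 3/2`
  have hh : (half P K K₀ : ℝ) = (P.L : ℝ) ^ K * K₀ := by unfold half; push_cast; ring
  have hhpos : (0 : ℝ) < half P K K₀ := by exact_mod_cast half_pos hK₀'
  have hrS := rS_le_real (P := P) (K := K) hK₀8
  have hexp : Real.exp (-(((⌈D⌉₊ : ℝ) - 4 * rS P K K₀) / (2 * half P K K₀)))
      ≤ Real.exp (3 / 2) * Real.exp (-(D / (2 * K₀ * (P.L : ℝ) ^ K))) := by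
    rw [← Real.exp_add]
    refine Real.exp_le_exp.2 ?_
    have hDc : D ≤ (⌈D⌉₊ : ℝ) := Nat.le_ceil D
    have e1 : D / (2 * K₀ * (P.L : ℝ) ^ K) = D / (2 * half P K K₀) := by rw [hh]; ring_nf
    rw [e1]
    have h4 : (4 * (rS P K K₀ : ℝ)) ≤ 3 * half P K K₀ := by linarith
    have h5 : -(3 / 2 : ℝ) ≤ ((⌈D⌉₊ : ℝ) - D - 4 * rS P K K₀) / (2 * half P K K₀) := by
      rw [le_div_iff₀ (by positivity)]
      linarith
    have e2 : ((⌈D⌉₊ : ℝ) - 4 * rS P K K₀) / (2 * half P K K₀) - D / (2 * half P K K₀)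
        = ((⌈D⌉₊ : ℝ) - D - 4 * rS P K K₀) / (2 * half P K K₀) := by ring
    linarith
  calc 2 * ((({x} : Finset (HiggsLattice.Site P 0)).card : ℝ) * 2 ^ P.d) * (Cg * P.mesh K ^ 2)
        * Real.exp (-(((⌈D⌉₊ : ℝ) - 4 * rS P K K₀) / (2 * half P K K₀))) * ‖g‖
      = 2 * 2 ^ P.d * (Cg * P.mesh K ^ 2) * Real.exp (-(((⌈D⌉₊ : ℝ) - 4 * rS P K K₀) / (2 * half P K K₀))) * ‖g‖ := by
        rw [Finset.card_singleton]; push_cast; ring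
    _ ≤ 2 * 2 ^ P.d * (Cg * P.mesh K ^ 2) * (Real.exp (3 / 2) * Real.exp (-(D / (2 * K₀ * (P.L : ℝ) ^ K)))) * M :=
        mul_le_mul (mul_le_mul_of_nonneg_left hexp (by positivity)) hgn (norm_nonneg _) (by positivity)
    _ = 2 * 2 ^ P.d * Cg * Real.exp (3 / 2) * P.mesh K ^ 2 * Real.exp (-(D / (2 * K₀ * (P.L : ℝ) ^ K))) * M := by ring

set_option maxHeartbeats 800000 in
/-- **PROP. 2.1 (2.25), DERIVATIVE MEMBER, FOR BOXES OF LARGE BLOCKS `Ω ⊂ T_ε` WITHOUT THE RESTRICTION `dist(x, Ωᶜ) ≥ R₀`, AT EVERY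
(2.23)-REGULAR VECTOR FIELD** («|(D^η_{A,μ}G_k(Ω, A)f)(x)| … similarly», p. 611 l.1–2 for parallelepipeds) ON THE CARRIER.  Same data as
the value member; for EVERY bond `⟨x, x + εe_μ⟩` WITH BOTH ENDS IN `Ω` (the bonds of the Neumann operator; no `R₀`) and every `g` supported
in a `K`-block with `‖g‖_∞ ≤ M′` vanishing at the sites within lattice distance `< D` of `x` (`D ≥ 0`):
`‖(D^ε_A G^ε_K(Ω, A)1_Ωg)(⟨x, μ⟩)‖ ≤ c₁(L^Kε)·exp(−D/(2K₀L^K))·M′` (one power of `L^Kε` less than the value member, as printed).  Proof =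
`chain_allgood_of_inputs_probe` with the derivative probe at `X₀ = {x, x + εe_μ}` fed by `box_letters` (the derivative letter at bonds inside
`Ω`), the tail `exists_deriv_tail_le'`.
[cite: Balaban1982Higgs1, Prop. 2.1 (2.23), (2.25) p.610, p.611 l.1–2] [cite: Balaban1983RegularityDecay, Theorem (1.10) p.573; (2.18)–(2.22) pp.578–579; p.579 L25–28] -/
theorem norm_covDeriv_propagatorK_box_reg_decay (d L : ℕ) (hd : 1 ≤ d) (hL : 2 ≤ L) {a : ℝ} (ha : 0 < a) {msq : ℝ} (hmsq : 0 < msq)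
    (N : ℕ) (C : ChargeData N) (ε₀ : ℝ) (creg β : ℝ) (hcreg : 0 ≤ creg) (hβ : 0 < β) :
    ∃ c₁ : ℝ, 0 < c₁ ∧ ∃ K₀min : ℕ, ∀ K₀ : ℕ, K₀min ≤ K₀ → ∃ e₁ : ℝ, 0 < e₁ ∧
      ∀ (P : HiggsLattice.Params), P.d = d → P.L = L → K₀ ∣ P.M →
      ∀ {K : ℕ}, 1 ≤ K → K ≤ P.K → (∀ μ, 3 * half P K K₀ ≤ P.sitesPerDir 0 μ) → P.mesh K ≤ ε₀ →
      ∀ (S : Fin P.d → Finset ℕ) (A : HiggsLattice.VecField P 0) {ec : ℝ}, 0 < ec → ec ≤ e₁ →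
      (∀ z ∈ cellBox K K₀ S, ∀ μ ν : Fin P.d,
          P.mesh K * |C.e| / ec * |A ⟨z.shift μ, ν⟩ - A ⟨z, ν⟩| ≤ creg * ec ^ (β - 1) / (P.L : ℝ) ^ K) →
      ∀ (x : HiggsLattice.Site P 0) (μ : Fin P.d), x ∈ cellBox K K₀ S → x.shift μ ∈ cellBox K K₀ S →
        ∀ (y₀ : HiggsLattice.Site P 0) (g : HiggsLattice.ScalarField P 0 N) (M D : ℝ),
          (∀ y, blockIter K y ≠ blockIter K y₀ → g y = 0) → (∀ y, ‖g y‖ ≤ M) → 0 ≤ D →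
          (∀ z, g z ≠ 0 → D ≤ (HiggsLattice.Site.tdist x z : ℝ)) →
            ‖covDeriv C A (propagatorK C (cellBox K K₀ S) A msq a K (chi (cellBox K K₀ S) • g)) ⟨x, μ⟩‖
              ≤ c₁ * P.mesh K * Real.exp (-(D / (2 * K₀ * (P.L : ℝ) ^ K))) * M := by
  have hℓ0 : 1 ≤ L - 1 := by omega
  obtain ⟨Cg, Cm, hCg, hCm, hL0⟩ := box_letters C (d - 1) (L - 1) hℓ0 ha hmsq (msq * ε₀ ^ 2) creg β hcreg hβ
  refine ⟨2 * (2 * 2 ^ d) * Cg * Real.exp 2, by positivity, max 8 ⌈(3 : ℝ) ^ d * Cm * Real.exp 1⌉₊, fun K₀ hK₀ => ?_⟩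
  have hK₀8 : 8 ≤ K₀ := le_trans (le_max_left _ _) hK₀
  have hK₀r : (0 : ℝ) < K₀ := by exact_mod_cast lt_of_lt_of_le (by norm_num) hK₀8
  have hK₀C : (3 : ℝ) ^ d * Cm * Real.exp 1 ≤ K₀ := (Nat.le_ceil _).trans (by exact_mod_cast le_trans (le_max_right _ _) hK₀)
  obtain ⟨e₁, he₁, hLK⟩ := hL0 K₀ hK₀8
  refine ⟨e₁, he₁, ?_⟩
  intro P hPd hPL hK₀M K hK1 hK hN3 hε S A ec hec hle hreg x μ hxΩ hsΩ y₀ g M D hg hgM hD0 hD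
  subst hPd
  have hdd : dd P = P.d - 1 := rfl
  have hPL1 : P.L - 1 = L - 1 := by rw [hPL]
  have hL1 : 1 < P.L := by rw [hPL]; omega
  have hL1r : (1 : ℝ) < P.L := by exact_mod_cast hL1
  have hak : 0 ≤ B1.aSeq a P.L K := (B1.aSeq_pos ha hL1r hK1).le
  have hK₀' : 1 ≤ K₀ := le_trans (by norm_num) hK₀8
  have hmesh : 0 < P.mesh K := P.mesh_pos K
  have hcap : msq * P.mesh K ^ 2 ≤ msq * ε₀ ^ 2 := mul_le_mul_of_nonneg_left (pow_le_pow_left₀ hmesh.le hε 2) hmsq.le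
  have hM0 : 0 ≤ M := (norm_nonneg _).trans (hgM x)
  have hgn : ‖g‖ ≤ M := (pi_norm_le_iff_of_nonneg hM0).2 hgM
  have hletters := hLK P hdd hPL1 hK1 hK hK₀M hN3 hcap S A hec hle hreg
  -- the letter constant and its smallness
  have hβK0 : 0 ≤ Cm / K₀ := div_nonneg hCm.le hK₀r.le
  have hDβ : (3 : ℝ) ^ P.d * (Cm / K₀) ≤ Real.exp (-1) := by
    rw [mul_div_assoc', div_le_iff₀ hK₀r]
    have h1 : Real.exp (-1) * Real.exp 1 = 1 := by rw [← Real.exp_add]; norm_num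
    have h2 : (3 : ℝ) ^ P.d * Cm = (3 : ℝ) ^ P.d * Cm * Real.exp 1 * Real.exp (-1) := by
      rw [mul_assoc ((3 : ℝ) ^ P.d * Cm), mul_comm (Real.exp 1), h1, mul_one]
    rw [h2]
    exact mul_le_mul_of_nonneg_right hK₀C (Real.exp_pos _).le |>.trans_eq (mul_comm _ _)
  have hsmall : 2 ^ P.d * (Cm / K₀) < 1 := by
    have h3 : (2 : ℝ) ^ P.d ≤ 3 ^ P.d := pow_le_pow_left₀ (by norm_num) (by norm_num) _
    have he : Real.exp (-1) < 1 := Real.exp_lt_one_iff.mpr (by norm_num)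
    nlinarith [mul_le_mul_of_nonneg_right h3 hβK0]
  have hγK0 : 0 ≤ Cg * P.mesh K := by positivity
  -- `g` vanishes within `⌈D⌉ − 1` of both end points
  have hfX : ∀ x' ∈ ({x, x.shift μ} : Finset (HiggsLattice.Site P 0)), ∀ y, g y ≠ 0 → ⌈D⌉₊ - 1 ≤ HiggsLattice.Site.tdist x' y := by
    intro x' hx' y hy
    have hDy : ⌈D⌉₊ ≤ HiggsLattice.Site.tdist x y := Nat.ceil_le.2 (hD y hy)
    simp only [Finset.mem_insert, Finset.mem_singleton] at hx'
    rcases hx' with h | h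
    · subst h; omega
    · subst h
      have h1 := tdist_shift_le_one x μ
      have h2 : (HiggsLattice.Site.tdist x y : ℝ) ≤ HiggsLattice.Site.tdist x (x.shift μ) + HiggsLattice.Site.tdist (x.shift μ) y :=
        tdist_triangle_real _ _ _
      have h3 : HiggsLattice.Site.tdist x y ≤ HiggsLattice.Site.tdist x (x.shift μ) + HiggsLattice.Site.tdist (x.shift μ) y := by
        exact_mod_cast h2
      omega
  -- the chain with the derivative probe at `⟨x, μ⟩`
  have hmain := chain_allgood_of_inputs_probe C (cellBox K K₀ S) A hK hK₀M hK₀8 hN3 (isBigBlockUnion_cellBox S) hmsq hak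
    (γ := Cg * P.mesh K) (β := Cm / K₀) hγK0 hβK0 hDβ (Φ := fun w => ‖covDeriv C A w ⟨x, μ⟩‖) (by simp [covDeriv_zero'])
    (fun u v => by simp only [covDeriv_add']; exact norm_add_le _ _)
    ({x, x.shift μ} : Finset (HiggsLattice.Site P 0))
    (fun i hi g' => by
      have hx1 : ¬ Near K K₀ (rS P K K₀) i x := hi x (by simp)
      have hx2 : ¬ Near K K₀ (rS P K K₀) i (x.shift μ) := hi (x.shift μ) (by simp)
      simp only [covDeriv_aOp_eq_zero C (cellBox K K₀ S) A hK hK₀M hK₀8 i g' hx1 hx2, norm_zero, le_refl])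
    (fun i g' hg' => (hletters i g' hg').2.1 x μ hxΩ hsΩ)
    (fun j ψ hψ => (hletters j ψ hψ).2.2)
    g (Dist := ⌈D⌉₊ - 1) hfX
    (exists_deriv_tail_le' C (cellBox K K₀ S) A hK hK₀M hK₀8 hβK0 hsmall (fun j ψ hψ => (hletters j ψ hψ).2.2) g ⟨x, μ⟩)
  refine hmain.trans ?_
  -- the exponent: `(⌈D⌉ − 1 − 4rS)/(2M) ≥ D/(2K₀L^K) − 2`
  have hh : (half P K K₀ : ℝ) = (P.L : ℝ) ^ K * K₀ := by unfold half; push_cast; ring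
  have hhpos : (0 : ℝ) < half P K K₀ := by exact_mod_cast half_pos hK₀'
  have hh1 : (1 : ℝ) ≤ half P K K₀ := by exact_mod_cast half_pos hK₀'
  have hrS := rS_le_real (P := P) (K := K) hK₀8
  have hcard : (({x, x.shift μ} : Finset (HiggsLattice.Site P 0)).card : ℝ) ≤ 2 := by
    exact_mod_cast (Finset.card_insert_le _ _).trans (by rw [Finset.card_singleton])
  have hDist : D - 1 ≤ (((⌈D⌉₊ - 1 : ℕ)) : ℝ) := by
    have hDc : D ≤ (⌈D⌉₊ : ℝ) := Nat.le_ceil D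
    rcases Nat.eq_zero_or_pos ⌈D⌉₊ with h0 | hpos
    · rw [h0]; simp; linarith [show (⌈D⌉₊ : ℝ) = 0 by exact_mod_cast h0]
    · rw [Nat.cast_sub hpos, Nat.cast_one]; linarith
  have hexp : Real.exp (-(((((⌈D⌉₊ - 1 : ℕ)) : ℝ) - 4 * rS P K K₀) / (2 * half P K K₀)))
      ≤ Real.exp 2 * Real.exp (-(D / (2 * K₀ * (P.L : ℝ) ^ K))) := by
    rw [← Real.exp_add]
    refine Real.exp_le_exp.2 ?_
    have e1 : D / (2 * K₀ * (P.L : ℝ) ^ K) = D / (2 * half P K K₀) := by rw [hh]; ring_nf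
    rw [e1]
    have h4 : (4 * (rS P K K₀ : ℝ)) + 1 ≤ 4 * half P K K₀ := by linarith
    have e2 : ((((⌈D⌉₊ - 1 : ℕ)) : ℝ) - 4 * rS P K K₀) / (2 * half P K K₀) - D / (2 * half P K K₀)
        = ((((⌈D⌉₊ - 1 : ℕ)) : ℝ) - D - 4 * rS P K K₀) / (2 * half P K K₀) := by ring
    have h5 : -(2 : ℝ) ≤ ((((⌈D⌉₊ - 1 : ℕ)) : ℝ) - D - 4 * rS P K K₀) / (2 * half P K K₀) := by
      rw [le_div_iff₀ (by positivity)]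
      linarith
    linarith
  calc 2 * ((({x, x.shift μ} : Finset (HiggsLattice.Site P 0)).card : ℝ) * 2 ^ P.d) * (Cg * P.mesh K)
        * Real.exp (-(((((⌈D⌉₊ - 1 : ℕ)) : ℝ) - 4 * rS P K K₀) / (2 * half P K K₀))) * ‖g‖
      ≤ 2 * (2 * 2 ^ P.d) * (Cg * P.mesh K) * (Real.exp 2 * Real.exp (-(D / (2 * K₀ * (P.L : ℝ) ^ K)))) * M := by
        refine mul_le_mul (mul_le_mul ?_ hexp (by positivity) (by positivity)) hgn (norm_nonneg _) (by positivity)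
        have h1 : (({x, x.shift μ} : Finset (HiggsLattice.Site P 0)).card : ℝ) * 2 ^ P.d ≤ 2 * 2 ^ P.d :=
          mul_le_mul_of_nonneg_right hcard (by positivity)
        have h2 : 2 * ((({x, x.shift μ} : Finset (HiggsLattice.Site P 0)).card : ℝ) * 2 ^ P.d) ≤ 2 * (2 * 2 ^ P.d) :=
          mul_le_mul_of_nonneg_left h1 (by norm_num)
        exact mul_le_mul_of_nonneg_right h2 (by positivity)
    _ = 2 * (2 * 2 ^ P.d) * Cg * Real.exp 2 * P.mesh K * Real.exp (-(D / (2 * K₀ * (P.L : ℝ) ^ K))) * M := by ring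

end Main

end Literature.MathematicalPhysics.QuantumFieldTheory.Balaban1983to89.B1Ineq225RegularBox
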